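import Literature.Computability.Complexity.StackWhile
import Literature.Computability.Complexity.FlatTranscripts
import HarnessLib

/-!
# The multi-pass transcript checker as a binary stack program

Literature / complexity toolkit: the machine `U` of the universal nondeterministic simulation
behind the nondeterministic time hierarchy theorem (`NTIMEHierarchyDiagonal.lean`), realising
the multi-pass check of `FlatTranscripts.lean` (`UFlat.UAccepts`) as ONE structured binary stack
program (`ACom Bool UChk.UR`, `SymbolPrograms.lean`) whose running time is LINEAR in the length
of its registers, with a universal constant — the transcript PAYS in advance, symbol for
symbol, for every piece of work whose size depends on the simulated program (the paid lockstep
`StackWhile.payLock`).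

Input registers: `code` — the uniform program `P` (`UFlat.UProg`), each instruction as five
unary blocks `1ᵃ 0` (`act, k, j₀, j₁, j₂`, `UChk.encProg`); `np = 1^{K}` — the number of
passes (= registers); `ky = 1^{K}` — a yardstick of the same length; `inp = 1^{inp}`,
`outr = 1^{out}`; `ini` — the initial content of register `inp`; `tr` — the transcript: the
claims `o₁ … o_t` as `1 (1^{o₁} 0) 1 (1^{o₂} 0) … 0` followed by payment symbols.

The program (`UChk.U`): build the yardstick `yard = 1^{|code|}`; move the claim copy from `tr`
to `cur2` (`dryParse`); then `K` passes, pass `p`: pay `|copy| + |code| + K` symbols; set the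
work stack `wk` to the initial content of register `p`; for every claim: pay `|code| + K`
symbols, and unless halted (code register exhausted) fetch the instruction at the cursor,
compare its register with `p` (`StackWhile.cmpUnary`), execute it on `wk` for real if equal —
a refuted claim raises `flag` — select the target, rewind the code and skip to the target; at
the end of the pass check that the cursor is halted and, in pass `out`, that `wk = [1]`.
Every failure raises `flag` and switches the rest of the run to a cheap skipping mode, so that
the time bound holds on ALL register contents (`UChk.runs_U`: `C · (|code| + |tr| + |ini| + K) + C`
steps), while `flag` stays empty iff the claims are accepted by `UFlat.UAccepts` and correctly
paid (`UChk.U_sound`, `UChk.U_complete`).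

## References

* R. V. Book, S. A. Greibach, B. Wegbreit, *Time- and tape-bounded Turing acceptors and AFLs*,
  JCSS 4 (1970) 606–621 (one tape at a time over a guessed display sequence).
* S. Arora, B. Barak, *Computational Complexity: A Modern Approach*, CUP 2009, Thm. 3.2 (proof),
  §1.4.
-/

namespace Literature.Computability.Complexity

open Function

namespace UChk

open ACom StackWhile


/-! ### Registers -/

/-- Registers of the checker. [folklore] -/
inductive UR
  | code | codeL | yard | yard2 | ycopy | ycopy2 | ky | ky2 | np | tr | cur | cur2 | wk | pp | pp2
  | inp | outr | ini | t1 | t2 | ac | kk | j0 | j1 | j2 | cl | ne | flag | w | wr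
  deriving DecidableEq, Fintype

/-- Stores of the checker. [folklore] -/
abbrev Store : Type := AStore Bool UR

/-- Programs of the checker. [folklore] -/
abbrev Prog : Type := ACom Bool UR

/-! ### Named stores -/

/-- The contents of all registers, by name (a record, so that stores are written with
structure-update syntax). [folklore] -/
structure USt where
  /-- register `code` -/
  code : List Bool := []
  /-- register `codeL` -/
  codeL : List Bool := []
  /-- register `yard` -/
  yard : List Bool := []
  /-- register `yard2` -/
  yard2 : List Bool := []
  /-- register `ycopy` -/
  ycopy : List Bool := []
  /-- register `ycopy2` -/
  ycopy2 : List Bool := []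
  /-- register `ky` -/
  ky : List Bool := []
  /-- register `ky2` -/
  ky2 : List Bool := []
  /-- register `np` -/
  np : List Bool := []
  /-- register `tr` -/
  tr : List Bool := []
  /-- register `cur` -/
  cur : List Bool := []
  /-- register `cur2` -/
  cur2 : List Bool := []
  /-- register `wk` -/
  wk : List Bool := []
  /-- register `pp` -/
  pp : List Bool := []
  /-- register `pp2` -/
  pp2 : List Bool := []
  /-- register `inp` -/
  inp : List Bool := []
  /-- register `outr` -/
  outr : List Bool := []
  /-- register `ini` -/
  ini : List Bool := []
  /-- register `t1` -/
  t1 : List Bool := []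
  /-- register `t2` -/
  t2 : List Bool := []
  /-- register `ac` -/
  ac : List Bool := []
  /-- register `kk` -/
  kk : List Bool := []
  /-- register `j0` -/
  j0 : List Bool := []
  /-- register `j1` -/
  j1 : List Bool := []
  /-- register `j2` -/
  j2 : List Bool := []
  /-- register `cl` -/
  cl : List Bool := []
  /-- register `ne` -/
  ne : List Bool := []
  /-- register `flag` -/
  flag : List Bool := []
  /-- register `w` -/
  w : List Bool := []
  /-- register `wr` -/
  wr : List Bool := []

/-- The store of a named record. [folklore] -/
def USt.store (s : USt) : Store
  | .code => s.code
  | .codeL => s.codeL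
  | .yard => s.yard
  | .yard2 => s.yard2
  | .ycopy => s.ycopy
  | .ycopy2 => s.ycopy2
  | .ky => s.ky
  | .ky2 => s.ky2
  | .np => s.np
  | .tr => s.tr
  | .cur => s.cur
  | .cur2 => s.cur2
  | .wk => s.wk
  | .pp => s.pp
  | .pp2 => s.pp2
  | .inp => s.inp
  | .outr => s.outr
  | .ini => s.ini
  | .t1 => s.t1
  | .t2 => s.t2
  | .ac => s.ac
  | .kk => s.kk
  | .j0 => s.j0
  | .j1 => s.j1
  | .j2 => s.j2
  | .cl => s.cl
  | .ne => s.ne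
  | .flag => s.flag
  | .w => s.w
  | .wr => s.wr

section StoreLemmas

variable (s : USt) (v : List Bool)

/-- Read-out of `code`. [folklore] -/
@[simp] theorem store_code : s.store .code = s.code := rfl
/-- Read-out of `codeL`. [folklore] -/
@[simp] theorem store_codeL : s.store .codeL = s.codeL := rfl
/-- Read-out of `yard`. [folklore] -/
@[simp] theorem store_yard : s.store .yard = s.yard := rfl
/-- Read-out of `yard2`. [folklore] -/
@[simp] theorem store_yard2 : s.store .yard2 = s.yard2 := rfl
/-- Read-out of `ycopy`. [folklore] -/
@[simp] theorem store_ycopy : s.store .ycopy = s.ycopy := rfl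
/-- Read-out of `ycopy2`. [folklore] -/
@[simp] theorem store_ycopy2 : s.store .ycopy2 = s.ycopy2 := rfl
/-- Read-out of `ky`. [folklore] -/
@[simp] theorem store_ky : s.store .ky = s.ky := rfl
/-- Read-out of `ky2`. [folklore] -/
@[simp] theorem store_ky2 : s.store .ky2 = s.ky2 := rfl
/-- Read-out of `np`. [folklore] -/
@[simp] theorem store_np : s.store .np = s.np := rfl
/-- Read-out of `tr`. [folklore] -/
@[simp] theorem store_tr : s.store .tr = s.tr := rfl
/-- Read-out of `cur`. [folklore] -/
@[simp] theorem store_cur : s.store .cur = s.cur := rfl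
/-- Read-out of `cur2`. [folklore] -/
@[simp] theorem store_cur2 : s.store .cur2 = s.cur2 := rfl
/-- Read-out of `wk`. [folklore] -/
@[simp] theorem store_wk : s.store .wk = s.wk := rfl
/-- Read-out of `pp`. [folklore] -/
@[simp] theorem store_pp : s.store .pp = s.pp := rfl
/-- Read-out of `pp2`. [folklore] -/
@[simp] theorem store_pp2 : s.store .pp2 = s.pp2 := rfl
/-- Read-out of `inp`. [folklore] -/
@[simp] theorem store_inp : s.store .inp = s.inp := rfl
/-- Read-out of `outr`. [folklore] -/
@[simp] theorem store_outr : s.store .outr = s.outr := rfl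
/-- Read-out of `ini`. [folklore] -/
@[simp] theorem store_ini : s.store .ini = s.ini := rfl
/-- Read-out of `t1`. [folklore] -/
@[simp] theorem store_t1 : s.store .t1 = s.t1 := rfl
/-- Read-out of `t2`. [folklore] -/
@[simp] theorem store_t2 : s.store .t2 = s.t2 := rfl
/-- Read-out of `ac`. [folklore] -/
@[simp] theorem store_ac : s.store .ac = s.ac := rfl
/-- Read-out of `kk`. [folklore] -/
@[simp] theorem store_kk : s.store .kk = s.kk := rfl
/-- Read-out of `j0`. [folklore] -/
@[simp] theorem store_j0 : s.store .j0 = s.j0 := rfl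
/-- Read-out of `j1`. [folklore] -/
@[simp] theorem store_j1 : s.store .j1 = s.j1 := rfl
/-- Read-out of `j2`. [folklore] -/
@[simp] theorem store_j2 : s.store .j2 = s.j2 := rfl
/-- Read-out of `cl`. [folklore] -/
@[simp] theorem store_cl : s.store .cl = s.cl := rfl
/-- Read-out of `ne`. [folklore] -/
@[simp] theorem store_ne : s.store .ne = s.ne := rfl
/-- Read-out of `flag`. [folklore] -/
@[simp] theorem store_flag : s.store .flag = s.flag := rfl
/-- Read-out of `w`. [folklore] -/
@[simp] theorem store_w : s.store .w = s.w := rfl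
/-- Read-out of `wr`. [folklore] -/
@[simp] theorem store_wr : s.store .wr = s.wr := rfl

/-- Update of `code`. [folklore] -/
@[simp] theorem update_store_code : update s.store .code v = { s with code := v }.store := by
  funext r; cases r <;> rfl
/-- Update of `codeL`. [folklore] -/
@[simp] theorem update_store_codeL : update s.store .codeL v = { s with codeL := v }.store := by
  funext r; cases r <;> rfl
/-- Update of `yard`. [folklore] -/
@[simp] theorem update_store_yard : update s.store .yard v = { s with yard := v }.store := by
  funext r; cases r <;> rfl
/-- Update of `yard2`. [folklore] -/
@[simp] theorem update_store_yard2 : update s.store .yard2 v = { s with yard2 := v }.store := by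
  funext r; cases r <;> rfl
/-- Update of `ycopy`. [folklore] -/
@[simp] theorem update_store_ycopy : update s.store .ycopy v = { s with ycopy := v }.store := by
  funext r; cases r <;> rfl
/-- Update of `ycopy2`. [folklore] -/
@[simp] theorem update_store_ycopy2 : update s.store .ycopy2 v = { s with ycopy2 := v }.store := by
  funext r; cases r <;> rfl
/-- Update of `ky`. [folklore] -/
@[simp] theorem update_store_ky : update s.store .ky v = { s with ky := v }.store := by
  funext r; cases r <;> rfl
/-- Update of `ky2`. [folklore] -/
@[simp] theorem update_store_ky2 : update s.store .ky2 v = { s with ky2 := v }.store := by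
  funext r; cases r <;> rfl
/-- Update of `np`. [folklore] -/
@[simp] theorem update_store_np : update s.store .np v = { s with np := v }.store := by
  funext r; cases r <;> rfl
/-- Update of `tr`. [folklore] -/
@[simp] theorem update_store_tr : update s.store .tr v = { s with tr := v }.store := by
  funext r; cases r <;> rfl
/-- Update of `cur`. [folklore] -/
@[simp] theorem update_store_cur : update s.store .cur v = { s with cur := v }.store := by
  funext r; cases r <;> rfl
/-- Update of `cur2`. [folklore] -/
@[simp] theorem update_store_cur2 : update s.store .cur2 v = { s with cur2 := v }.store := by
  funext r; cases r <;> rfl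
/-- Update of `wk`. [folklore] -/
@[simp] theorem update_store_wk : update s.store .wk v = { s with wk := v }.store := by
  funext r; cases r <;> rfl
/-- Update of `pp`. [folklore] -/
@[simp] theorem update_store_pp : update s.store .pp v = { s with pp := v }.store := by
  funext r; cases r <;> rfl
/-- Update of `pp2`. [folklore] -/
@[simp] theorem update_store_pp2 : update s.store .pp2 v = { s with pp2 := v }.store := by
  funext r; cases r <;> rfl
/-- Update of `inp`. [folklore] -/
@[simp] theorem update_store_inp : update s.store .inp v = { s with inp := v }.store := by
  funext r; cases r <;> rfl
/-- Update of `outr`. [folklore] -/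
@[simp] theorem update_store_outr : update s.store .outr v = { s with outr := v }.store := by
  funext r; cases r <;> rfl
/-- Update of `ini`. [folklore] -/
@[simp] theorem update_store_ini : update s.store .ini v = { s with ini := v }.store := by
  funext r; cases r <;> rfl
/-- Update of `t1`. [folklore] -/
@[simp] theorem update_store_t1 : update s.store .t1 v = { s with t1 := v }.store := by
  funext r; cases r <;> rfl
/-- Update of `t2`. [folklore] -/
@[simp] theorem update_store_t2 : update s.store .t2 v = { s with t2 := v }.store := by
  funext r; cases r <;> rfl
/-- Update of `ac`. [folklore] -/
@[simp] theorem update_store_ac : update s.store .ac v = { s with ac := v }.store := by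
  funext r; cases r <;> rfl
/-- Update of `kk`. [folklore] -/
@[simp] theorem update_store_kk : update s.store .kk v = { s with kk := v }.store := by
  funext r; cases r <;> rfl
/-- Update of `j0`. [folklore] -/
@[simp] theorem update_store_j0 : update s.store .j0 v = { s with j0 := v }.store := by
  funext r; cases r <;> rfl
/-- Update of `j1`. [folklore] -/
@[simp] theorem update_store_j1 : update s.store .j1 v = { s with j1 := v }.store := by
  funext r; cases r <;> rfl
/-- Update of `j2`. [folklore] -/
@[simp] theorem update_store_j2 : update s.store .j2 v = { s with j2 := v }.store := by
  funext r; cases r <;> rfl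
/-- Update of `cl`. [folklore] -/
@[simp] theorem update_store_cl : update s.store .cl v = { s with cl := v }.store := by
  funext r; cases r <;> rfl
/-- Update of `ne`. [folklore] -/
@[simp] theorem update_store_ne : update s.store .ne v = { s with ne := v }.store := by
  funext r; cases r <;> rfl
/-- Update of `flag`. [folklore] -/
@[simp] theorem update_store_flag : update s.store .flag v = { s with flag := v }.store := by
  funext r; cases r <;> rfl
/-- Update of `w`. [folklore] -/
@[simp] theorem update_store_w : update s.store .w v = { s with w := v }.store := by
  funext r; cases r <;> rfl
/-- Update of `wr`. [folklore] -/
@[simp] theorem update_store_wr : update s.store .wr v = { s with wr := v }.store := by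
  funext r; cases r <;> rfl

end StoreLemmas

/-! ### The program -/

/-- The branches of `ifFlag`. [folklore] -/
def ifFlagBr (A B : Prog) : Option Bool → Prog
  | some _ => push .flag true ;; A
  | none => B

/-- `ifFlag A B`: run `A` if `flag` is raised (keeping it raised), else `B`. [folklore] -/
def ifFlag (A B : Prog) : Prog := pop .flag (ifFlagBr A B)

/-- `buildYard`: `yard := 1^{|code|}`, keeping `code`. [folklore] -/
def buildYard : Prog := (loop .code fun b => push .codeL b ;; push .yard true) ;; pour .codeL .code

/-- The body of `dryParse`: a record marker `1` is followed by a claim block, moved to `cur`;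
the terminator `0` ends the copy; an exhausted `tr` raises `flag`. [folklore] -/
def dryBody : Option Bool → Prog
  | some true => push .cur true ;; push .ycopy true ;; push .ycopy true ;; moveBlock .tr .cur .ycopy .w ;;
      push .wr true
  | some false => push .cur false ;; push .ycopy true
  | none => push .flag true

/-- `dryParse`: move the claim copy from `tr` onto `cur` (reversed), counting its symbols on
`ycopy`, then pour it to `cur2` (forward). [folklore] -/
def dryParse : Prog :=
  push .wr true ;; (loop .wr fun _ => pop .tr dryBody) ;; pour .cur .cur2

/-- `pay y y2`: consume `|y|` payment symbols from `tr` (raising `flag` if short), keeping `y`.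
[folklore] -/
def pay (y y2 : UR) : Prog := payLock y y2 .tr .flag .w ;; pour y2 y

/-- `sel0 / sel1 / sel2`: keep the selected target on `j0`, clear the other two. [folklore] -/
def sel0 : Prog := clear .j1 ;; clear .j2
/-- See `sel0`. [folklore] -/
def sel1 : Prog := clear .j0 ;; pour .j1 .j0 ;; clear .j2
/-- See `sel0`. [folklore] -/
def sel2 : Prog := clear .j0 ;; clear .j1 ;; pour .j2 .j0

/-- A refuted claim: raise `flag` (target irrelevant, normalised to `j0`). [folklore] -/
def reject : Prog := clear .cl ;; push .flag true ;; sel0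

/-- The branches of `doPush`: push on `wk` iff the register is the pass register (`ne` empty).
[folklore] -/
def pushBr (b : Bool) : Option Bool → Prog
  | none => push .wk b
  | some _ => clear .ne

/-- `doPush b`: a push instruction; target `j₀`; the claim is ignored. [folklore] -/
def doPush (b : Bool) : Prog := pop .ne (pushBr b) ;; sel0 ;; clear .cl

/-- The inner branch of `trustSel` (after one claim token). [folklore] -/
def trustSel2 : Option Bool → Prog
  | none => sel1
  | some _ => clear .cl ;; sel2

/-- The outer branch of `trustSel`. [folklore] -/
def trustSel1 : Option Bool → Prog
  | none => sel0
  | some _ => pop .cl trustSel2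

/-- Target selection by a trusted claim `cl = 1ᵒ`: `j₀ / j₁ / j₂` for `o = 0 / 1 / ≥ 2`.
[folklore] -/
def trustSel : Prog := pop .cl trustSel1

/-- Checking a claim against the observation `0` (empty register): branch on `cl`. [folklore] -/
def chk0 : Option Bool → Prog
  | none => sel0
  | some _ => reject

/-- Checking against the observation `1`, second claim token. [folklore] -/
def chk1b : Option Bool → Prog
  | none => sel1
  | some _ => reject

/-- Checking against the observation `1`, first claim token. [folklore] -/
def chk1 : Option Bool → Prog
  | none => reject
  | some _ => pop .cl chk1b

/-- Checking against the observation `2`, third claim token. [folklore] -/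
def chk2c : Option Bool → Prog
  | none => sel2
  | some _ => reject

/-- Checking against the observation `2`, second claim token. [folklore] -/
def chk2b : Option Bool → Prog
  | none => reject
  | some _ => pop .cl chk2c

/-- Checking against the observation `2`, first claim token. [folklore] -/
def chk2 : Option Bool → Prog
  | none => reject
  | some _ => pop .cl chk2b

/-- The branches of `checkSel` on the popped top of `wk` (the actual observation). [folklore] -/
def chkTop : Option Bool → Prog
  | none => pop .cl chk0
  | some false => pop .cl chk1
  | some true => pop .cl chk2

/-- A pop of the pass register: the claim must be the actual observation of `wk` (which is
popped); select accordingly, else `reject`. [folklore] -/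
def checkSel : Prog := pop .wk chkTop

/-- The branches of `doPop`: trusted if the register is not the pass register. [folklore] -/
def popBr : Option Bool → Prog
  | some _ => clear .ne ;; trustSel
  | none => checkSel

/-- A pop instruction. [folklore] -/
def doPop : Prog := pop .ne popBr

/-- The branches of `exec` on the second action token. [folklore] -/
def execBr2 : Option Bool → Prog
  | none => doPush true
  | some _ => clear .ac ;; doPop

/-- The branches of `exec` on the first action token. [folklore] -/
def execBr1 : Option Bool → Prog
  | none => doPush false
  | some _ => pop .ac execBr2

/-- `exec`: compare the fetched register `kk` with the pass index `pp`; dispatch on the action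
`ac = 1^{act}`. [folklore] -/
def exec : Prog := (cmpUnary .kk .pp .pp2 .ne ;; pour .pp2 .pp) ;; pop .ac execBr1

/-- `fetch`: move the five fields of the instruction at the cursor to `codeL`, counting them on
`ac, kk, j0, j1, j2`. [folklore] -/
def fetch : Prog :=
  moveBlock .code .codeL .ac .w ;; moveBlock .code .codeL .kk .w ;; moveBlock .code .codeL .j0 .w ;;
    moveBlock .code .codeL .j1 .w ;; moveBlock .code .codeL .j2 .w

/-- `skip1`: move one instruction (five blocks) from `code` to `codeL`. [folklore] -/
def skip1 : Prog :=
  moveBlock .code .codeL .t1 .w ;; moveBlock .code .codeL .t1 .w ;; moveBlock .code .codeL .t1 .w ;;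
    moveBlock .code .codeL .t1 .w ;; moveBlock .code .codeL .t1 .w ;; clear .t1

/-- The branches of `step` on the first code symbol (halted iff none). [folklore] -/
def stepBr : Option Bool → Prog
  | none => clear .cl
  | some b => push .code b ;; fetch ;; exec ;; pour .codeL .code ;; loop .j0 fun _ => skip1

/-- `step`: one simulated step on the claim `cl`: nothing if halted (cursor at the end), else
fetch, execute, rewind the code and skip to the selected target `j0`. [folklore] -/
def step : Prog := pop .code stepBr

/-- A record in skipping mode: read the claim and discard it. [folklore] -/
def recSkip : Prog := moveBlock .cur2 .cur .cl .w ;; clear .cl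

/-- A record in working mode: read the claim, pay `|code| + K`, do a `step` unless flagged.
[folklore] -/
def recWork : Prog :=
  moveBlock .cur2 .cur .cl .w ;; pay .yard .yard2 ;; pay .ky .ky2 ;; ifFlag (clear .cl) step

/-- The body of the record loop on the first symbol of `cur2`: a record marker `1`, the
terminator `0`, or nothing (malformed). [folklore] -/
def recBody : Option Bool → Prog
  | some true => push .cur true ;; ifFlag recSkip recWork ;; push .wr true
  | some false => push .cur false
  | none => push .flag true

/-- The record loop of a pass. [folklore] -/
def recLoop : Prog := push .wr true ;; loop .wr fun _ => pop .cur2 recBody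

/-- `copyUn src`: copy the unary register `src` onto `t1`, keeping `src`. [folklore] -/
def copyUn (src : UR) : Prog := copy2 src .t1 .t2 ;; pour .t2 src

/-- The branches of `initWk`: copy `ini` onto the work stack iff the pass index is `inp`.
[folklore] -/
def iniBr : Option Bool → Prog
  | some _ => clear .ne
  | none => copy2 .ini .t1 .t2 ;; pour .t1 .wk ;; pour .t2 .ini

/-- `initWk`: if the pass index equals `inp`, copy `ini` onto the work stack (in order, keeping
`ini`). [folklore] -/
def initWk : Prog := copyUn .inp ;; (cmpUnary .t1 .pp .pp2 .ne ;; pour .pp2 .pp) ;; pop .ne iniBr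

/-- The check of pass `out`, second symbol: there must be none. [folklore] -/
def wkBr2 : Option Bool → Prog
  | none => skip
  | some _ => push .flag true

/-- The check of pass `out`, first symbol: it must be `1`. [folklore] -/
def wkBr1 : Option Bool → Prog
  | some true => pop .wk wkBr2
  | _ => push .flag true

/-- The check of pass `out`: the work stack must be exactly `[1]`. [folklore] -/
def checkWk : Prog := pop .wk wkBr1

/-- The halting check: the code register must be exhausted. [folklore] -/
def haltBr : Option Bool → Prog
  | none => skip
  | some b => push .code b ;; push .flag true

/-- The branches of the output check: only in pass `out` (`ne` empty). [folklore] -/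
def outBr : Option Bool → Prog
  | some _ => clear .ne
  | none => checkWk

/-- `finish`: the cursor must be halted; in pass `out` the work stack must be `[1]`; clean up
and restore the claim copy for the next pass. [folklore] -/
def finish : Prog :=
  pop .code haltBr ;; copyUn .outr ;; (cmpUnary .t1 .pp .pp2 .ne ;; pour .pp2 .pp) ;; pop .ne outBr ;;
  clear .wk ;; pour .codeL .code ;; clear .cur2 ;; pour .cur .cur2

/-- One pass: pay `|copy| + |code| + K`; unless flagged, initialise the work stack, run the
record loop and finish. [folklore] -/
def pass : Prog :=
  (pay .ycopy .ycopy2 ;; pay .yard .yard2 ;; pay .ky .ky2) ;; ifFlag skip (initWk ;; recLoop ;; finish)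

/-- The pass loop: one pass per token of `np`, the pass index counted on `pp`. [folklore] -/
def passes : Prog := loop .np fun _ => ifFlag skip pass ;; push .pp true

/-- **The transcript checker.** [cite: AroraBarak2009, Thm. 3.2 (proof)] -/
def U : Prog :=
  buildYard ;; dryParse ;; ifFlag skip passes ;; clear .pp ;; clear .np ;; clear .yard ;; clear .ycopy ;;
    clear .cur ;; clear .cur2 ;; clear .tr

/-! ### The generic routines on named stores -/

/-- `moveBlock` from `code` to `codeL`, counting on `cnt`. [folklore] -/
theorem runs_moveBlock_code (cnt : UR) (h1 : cnt ≠ .code) (h2 : cnt ≠ .codeL) (h3 : cnt ≠ .w)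
    (s : USt) {a : ℕ} {t : List Bool} (ht : IsTail t) (hc : s.code = un a ++ t) (hw : s.w = []) :
    Runs (moveBlock .code .codeL cnt .w) s.store
      (update { s with code := t.tail, codeL := t.take 1 ++ un a ++ s.codeL }.store cnt
        (un a ++ s.store cnt)) (7 * a + 7) := by
  obtain ⟨R', hR, g1, g2, g3, g4, g5⟩ := runs_moveBlock (src := UR.code) (dst := UR.codeL)
    (cnt := cnt) (w := UR.w) (by decide) (by decide) h3 (by decide) h1.symm h2.symm ht s.store
    (by simpa using hc) (by simpa using hw)
  convert hR using 1
  symm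
  funext r
  by_cases hr : r = cnt
  · subst hr; rw [update_self, g3]
  · rw [update_of_ne hr]
    cases r <;> first
      | (rw [g1]; simp [USt.store])
      | (rw [g2]; simp [USt.store])
      | (rw [g4]; simp [USt.store, hw])
      | (rw [g5 _ (by decide) (by decide) hr (by decide)]; simp [USt.store])

/-- `moveBlock` from `cur2` to `cur`, counting on `cl` (reading a claim). [folklore] -/
theorem runs_moveBlock_cur2 (s : USt) {a : ℕ} {t : List Bool} (ht : IsTail t)
    (hc : s.cur2 = un a ++ t) (hw : s.w = []) :
    Runs (moveBlock .cur2 .cur .cl .w) s.store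
      { s with cur2 := t.tail, cur := t.take 1 ++ un a ++ s.cur, cl := un a ++ s.cl }.store
      (7 * a + 7) := by
  obtain ⟨R', hR, g1, g2, g3, g4, g5⟩ := runs_moveBlock (src := UR.cur2) (dst := UR.cur)
    (cnt := UR.cl) (w := UR.w) (by decide) (by decide) (by decide) (by decide) (by decide) (by decide)
    ht s.store (by simpa using hc) (by simpa using hw)
  convert hR using 1
  symm
  funext r
  cases r <;> first
    | (rw [g1]; simp [USt.store])
    | (rw [g2]; simp [USt.store])
    | (rw [g3]; simp [USt.store])
    | (rw [g4]; simp [USt.store, hw])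
    | (rw [g5 _ (by decide) (by decide) (by decide) (by decide)]; simp [USt.store])

/-- `moveBlock` from `tr` to `cur`, counting on `ycopy` (the dry parse). [folklore] -/
theorem runs_moveBlock_tr (s : USt) {a : ℕ} {t : List Bool} (ht : IsTail t)
    (hc : s.tr = un a ++ t) (hw : s.w = []) :
    Runs (moveBlock .tr .cur .ycopy .w) s.store
      { s with tr := t.tail, cur := t.take 1 ++ un a ++ s.cur, ycopy := un a ++ s.ycopy }.store
      (7 * a + 7) := by
  obtain ⟨R', hR, g1, g2, g3, g4, g5⟩ := runs_moveBlock (src := UR.tr) (dst := UR.cur)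
    (cnt := UR.ycopy) (w := UR.w) (by decide) (by decide) (by decide) (by decide) (by decide)
    (by decide) ht s.store (by simpa using hc) (by simpa using hw)
  convert hR using 1
  symm
  funext r
  cases r <;> first
    | (rw [g1]; simp [USt.store])
    | (rw [g2]; simp [USt.store])
    | (rw [g3]; simp [USt.store])
    | (rw [g4]; simp [USt.store, hw])
    | (rw [g5 _ (by decide) (by decide) (by decide) (by decide)]; simp [USt.store])

/-- **`pay ycopy ycopy2`, payment sufficient**: `tr` loses `n = |ycopy|` symbols, everything else is
unchanged (`ycopy2` empty before and after), within `11n + 7` steps. [folklore] -/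
theorem runs_pay_ycopy_ok (s : USt) {n : ℕ} (hy : s.ycopy = un n) (hy2 : s.ycopy2 = [])
    (hn : n ≤ s.tr.length) (hw : s.w = []) :
    Runs (pay .ycopy .ycopy2) s.store { s with tr := s.tr.drop n }.store (11 * n + 7) := by
  obtain ⟨R', hR, g1, g2, g3, g4, g5⟩ := runs_payLock_ok (y := UR.ycopy) (y2 := UR.ycopy2) (tr := UR.tr)
    (flag := UR.flag) (w := UR.w) (by decide) (by decide) (by decide) (by decide) (by decide)
    (by decide) s.store (by simpa using hy) (by simpa using hn) (by simpa using hw)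
  have h2 := runs_pour (Γ := Bool) (a := UR.ycopy2) (b := UR.ycopy) (by decide) R'
  refine (hR.seq h2).of_eq ?_ ?_
  · funext r
    cases r <;> simp [g1, g2, g3, g4, hy, hy2, hw, USt.store, g5]
  · rw [g2]; simp [hy2]; omega

/-- **`pay ycopy ycopy2`, payment short** (`|tr| = m < n = |ycopy|`): `tr` is emptied and `flag`
raised, `ycopy` restored, within `11m + 14` steps. [folklore] -/
theorem runs_pay_ycopy_short (s : USt) {m n : ℕ} (hy : s.ycopy = un n) (hy2 : s.ycopy2 = [])
    (hm : s.tr.length = m) (hmn : m < n) (hw : s.w = []) :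
    Runs (pay .ycopy .ycopy2) s.store { s with tr := [], flag := true :: s.flag }.store (11 * m + 14) := by
  obtain ⟨R', hR, g1, g2, g3, g4, g5, g6⟩ := runs_payLock_short (y := UR.ycopy) (y2 := UR.ycopy2)
    (tr := UR.tr) (flag := UR.flag) (w := UR.w) (by decide) (by decide) (by decide) (by decide)
    (by decide) (by decide) (by decide) (by decide) (by decide) (by decide) s.store
    (by simpa using hy) (by simpa using hm) hmn (by simpa using hw)
  have h2 := runs_pour (Γ := Bool) (a := UR.ycopy2) (b := UR.ycopy) (by decide) R'
  refine (hR.seq h2).of_eq ?_ ?_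
  · funext r
    cases r <;> simp [g1, g2, g3, g4, g5, hy, hy2, hw, USt.store, g6]
    omega
  · rw [g2]; simp [hy2]; omega

/-- **`pay yard yard2`, payment sufficient**: `tr` loses `n = |yard|` symbols, everything else is
unchanged (`yard2` empty before and after), within `11n + 7` steps. [folklore] -/
theorem runs_pay_yard_ok (s : USt) {n : ℕ} (hy : s.yard = un n) (hy2 : s.yard2 = [])
    (hn : n ≤ s.tr.length) (hw : s.w = []) :
    Runs (pay .yard .yard2) s.store { s with tr := s.tr.drop n }.store (11 * n + 7) := by
  obtain ⟨R', hR, g1, g2, g3, g4, g5⟩ := runs_payLock_ok (y := UR.yard) (y2 := UR.yard2) (tr := UR.tr)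
    (flag := UR.flag) (w := UR.w) (by decide) (by decide) (by decide) (by decide) (by decide)
    (by decide) s.store (by simpa using hy) (by simpa using hn) (by simpa using hw)
  have h2 := runs_pour (Γ := Bool) (a := UR.yard2) (b := UR.yard) (by decide) R'
  refine (hR.seq h2).of_eq ?_ ?_
  · funext r
    cases r <;> simp [g1, g2, g3, g4, hy, hy2, hw, USt.store, g5]
  · rw [g2]; simp [hy2]; omega

/-- **`pay yard yard2`, payment short** (`|tr| = m < n = |yard|`): `tr` is emptied and `flag`
raised, `yard` restored, within `11m + 14` steps. [folklore] -/
theorem runs_pay_yard_short (s : USt) {m n : ℕ} (hy : s.yard = un n) (hy2 : s.yard2 = [])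
    (hm : s.tr.length = m) (hmn : m < n) (hw : s.w = []) :
    Runs (pay .yard .yard2) s.store { s with tr := [], flag := true :: s.flag }.store (11 * m + 14) := by
  obtain ⟨R', hR, g1, g2, g3, g4, g5, g6⟩ := runs_payLock_short (y := UR.yard) (y2 := UR.yard2)
    (tr := UR.tr) (flag := UR.flag) (w := UR.w) (by decide) (by decide) (by decide) (by decide)
    (by decide) (by decide) (by decide) (by decide) (by decide) (by decide) s.store
    (by simpa using hy) (by simpa using hm) hmn (by simpa using hw)
  have h2 := runs_pour (Γ := Bool) (a := UR.yard2) (b := UR.yard) (by decide) R'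
  refine (hR.seq h2).of_eq ?_ ?_
  · funext r
    cases r <;> simp [g1, g2, g3, g4, g5, hy, hy2, hw, USt.store, g6]
    omega
  · rw [g2]; simp [hy2]; omega

/-- **`pay ky ky2`, payment sufficient**: `tr` loses `n = |ky|` symbols, everything else is
unchanged (`ky2` empty before and after), within `11n + 7` steps. [folklore] -/
theorem runs_pay_ky_ok (s : USt) {n : ℕ} (hy : s.ky = un n) (hy2 : s.ky2 = [])
    (hn : n ≤ s.tr.length) (hw : s.w = []) :
    Runs (pay .ky .ky2) s.store { s with tr := s.tr.drop n }.store (11 * n + 7) := by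
  obtain ⟨R', hR, g1, g2, g3, g4, g5⟩ := runs_payLock_ok (y := UR.ky) (y2 := UR.ky2) (tr := UR.tr)
    (flag := UR.flag) (w := UR.w) (by decide) (by decide) (by decide) (by decide) (by decide)
    (by decide) s.store (by simpa using hy) (by simpa using hn) (by simpa using hw)
  have h2 := runs_pour (Γ := Bool) (a := UR.ky2) (b := UR.ky) (by decide) R'
  refine (hR.seq h2).of_eq ?_ ?_
  · funext r
    cases r <;> simp [g1, g2, g3, g4, hy, hy2, hw, USt.store, g5]
  · rw [g2]; simp [hy2]; omega

/-- **`pay ky ky2`, payment short** (`|tr| = m < n = |ky|`): `tr` is emptied and `flag`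
raised, `ky` restored, within `11m + 14` steps. [folklore] -/
theorem runs_pay_ky_short (s : USt) {m n : ℕ} (hy : s.ky = un n) (hy2 : s.ky2 = [])
    (hm : s.tr.length = m) (hmn : m < n) (hw : s.w = []) :
    Runs (pay .ky .ky2) s.store { s with tr := [], flag := true :: s.flag }.store (11 * m + 14) := by
  obtain ⟨R', hR, g1, g2, g3, g4, g5, g6⟩ := runs_payLock_short (y := UR.ky) (y2 := UR.ky2)
    (tr := UR.tr) (flag := UR.flag) (w := UR.w) (by decide) (by decide) (by decide) (by decide)
    (by decide) (by decide) (by decide) (by decide) (by decide) (by decide) s.store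
    (by simpa using hy) (by simpa using hm) hmn (by simpa using hw)
  have h2 := runs_pour (Γ := Bool) (a := UR.ky2) (b := UR.ky) (by decide) R'
  refine (hR.seq h2).of_eq ?_ ?_
  · funext r
    cases r <;> simp [g1, g2, g3, g4, g5, hy, hy2, hw, USt.store, g6]
    omega
  · rw [g2]; simp [hy2]; omega

/-- `cmpUnary kk pp pp2 ne ;; pour pp2 pp`: compare the counter `kk` (consumed) with the pass
index (kept); `ne` receives tokens iff they differ. [folklore] -/
theorem runs_cmpPP_kk (s : USt) {x p : ℕ} (hx : s.kk = un x) (hp : s.pp = un p)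
    (hp2 : s.pp2 = []) :
    Runs (cmpUnary .kk .pp .pp2 .ne ;; pour .pp2 .pp) s.store
      { s with kk := [], ne := un (x - p + if x < p then 1 else 0) ++ s.ne }.store (8 * x + 6) := by
  obtain ⟨R', hR, g1, g2, g3, g4, g5⟩ := runs_cmpUnary (a := UR.kk) (b := UR.pp) (b2 := UR.pp2)
    (ne := UR.ne) (by decide) (by decide) (by decide) (by decide) (by decide) (by decide) s.store
    (by simpa using hx) (by simpa using hp)
  have h2 := runs_pour (Γ := Bool) (a := UR.pp2) (b := UR.pp) (by decide) R'
  refine (hR.seq h2).of_eq ?_ ?_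
  · funext r
    cases r <;> simp [g1, g2, g3, g4, hp, hp2, USt.store, g5, un]
    omega
  · rw [g3]; simp [hp2]; omega

/-- `cmpUnary t1 pp pp2 ne ;; pour pp2 pp`: compare the counter `t1` (consumed) with the pass
index (kept); `ne` receives tokens iff they differ. [folklore] -/
theorem runs_cmpPP_t1 (s : USt) {x p : ℕ} (hx : s.t1 = un x) (hp : s.pp = un p)
    (hp2 : s.pp2 = []) :
    Runs (cmpUnary .t1 .pp .pp2 .ne ;; pour .pp2 .pp) s.store
      { s with t1 := [], ne := un (x - p + if x < p then 1 else 0) ++ s.ne }.store (8 * x + 6) := by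
  obtain ⟨R', hR, g1, g2, g3, g4, g5⟩ := runs_cmpUnary (a := UR.t1) (b := UR.pp) (b2 := UR.pp2)
    (ne := UR.ne) (by decide) (by decide) (by decide) (by decide) (by decide) (by decide) s.store
    (by simpa using hx) (by simpa using hp)
  have h2 := runs_pour (Γ := Bool) (a := UR.pp2) (b := UR.pp) (by decide) R'
  refine (hR.seq h2).of_eq ?_ ?_
  · funext r
    cases r <;> simp [g1, g2, g3, g4, hp, hp2, USt.store, g5, un]
    omega
  · rw [g3]; simp [hp2]; omega

/-! ### Target selection and the execution of one instruction -/

/-- `clear` on a named register holding a word of length `n` (cost form). [folklore] -/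
theorem runs_clear_of {k : UR} (s : USt) {S' : Store} (hS : update s.store k [] = S') {n : ℕ}
    (hn : (s.store k).length = n) : Runs (clear k) s.store S' (2 * n + 1) :=
  (runs_clear (Γ := Bool) k s.store).of_eq hS (by rw [hn])

/-- `pour` between named registers (cost form). [folklore] -/
theorem runs_pour_of {a b : UR} (hab : a ≠ b) (s : USt) {S' : Store}
    (hS : update (update s.store a []) b ((s.store a).reverse ++ s.store b) = S') {n : ℕ}
    (hn : (s.store a).length = n) : Runs (pour a b) s.store S' (3 * n + 1) :=
  (runs_pour (Γ := Bool) hab s.store).of_eq hS (by rw [hn])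

/-- `sel0`. [folklore] -/
theorem runs_sel0 (s : USt) {b c : ℕ} (h1 : s.j1 = un b) (h2 : s.j2 = un c) :
    Runs sel0 s.store { s with j1 := [], j2 := [] }.store ((2 * b + 1) + (2 * c + 1)) := by
  have e1 : Runs (clear .j1) s.store { s with j1 := [] }.store (2 * b + 1) :=
    runs_clear_of s (by simp) (by simp [h1])
  have e2 : Runs (clear .j2) { s with j1 := [] }.store { s with j1 := [], j2 := [] }.store (2 * c + 1) :=
    runs_clear_of _ (by simp) (by simp [h2])
  exact e1.seq e2

/-- `sel1`. [folklore] -/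
theorem runs_sel1 (s : USt) {a b c : ℕ} (h0 : s.j0 = un a) (h1 : s.j1 = un b) (h2 : s.j2 = un c) :
    Runs sel1 s.store { s with j0 := un b, j1 := [], j2 := [] }.store
      ((2 * a + 1) + ((3 * b + 1) + (2 * c + 1))) := by
  have e1 : Runs (clear .j0) s.store { s with j0 := [] }.store (2 * a + 1) :=
    runs_clear_of s (by simp) (by simp [h0])
  have e2 : Runs (pour .j1 .j0) { s with j0 := [] }.store { s with j0 := un b, j1 := [] }.store
      (3 * b + 1) := runs_pour_of (by decide) _ (by simp [h1, un]) (by simp [h1])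
  have e3 : Runs (clear .j2) { s with j0 := un b, j1 := [] }.store
      { s with j0 := un b, j1 := [], j2 := [] }.store (2 * c + 1) := runs_clear_of _ (by simp) (by simp [h2])
  exact e1.seq (e2.seq e3)

/-- `sel2`. [folklore] -/
theorem runs_sel2 (s : USt) {a b c : ℕ} (h0 : s.j0 = un a) (h1 : s.j1 = un b) (h2 : s.j2 = un c) :
    Runs sel2 s.store { s with j0 := un c, j1 := [], j2 := [] }.store
      ((2 * a + 1) + ((2 * b + 1) + (3 * c + 1))) := by
  have e1 : Runs (clear .j0) s.store { s with j0 := [] }.store (2 * a + 1) :=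
    runs_clear_of s (by simp) (by simp [h0])
  have e2 : Runs (clear .j1) { s with j0 := [] }.store { s with j0 := [], j1 := [] }.store (2 * b + 1) :=
    runs_clear_of _ (by simp) (by simp [h1])
  have e3 : Runs (pour .j2 .j0) { s with j0 := [], j1 := [] }.store
      { s with j0 := un c, j1 := [], j2 := [] }.store (3 * c + 1) :=
    runs_pour_of (by decide) _ (by simp [h2, un]) (by simp [h2])
  exact e1.seq (e2.seq e3)

/-- The selected target: `j₀ / j₁ / j₂` for the observation code `0 / 1 / ≥ 2`. [folklore] -/
def selv (o j0 j1 j2 : ℕ) : ℕ := if o = 0 then j0 else if o = 1 then j1 else j2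

/-- A cost bound for the selection/rejection part of an execution. [folklore] -/
def selCost (o j0 j1 j2 : ℕ) : ℕ := 3 * (j0 + j1 + j2) + 2 * o + 16

/-- `reject`. [folklore] -/
theorem runs_reject (s : USt) {o a b c : ℕ} (hc : s.cl = un o) (h1 : s.j1 = un b)
    (h2 : s.j2 = un c) (ha : s.j0 = un a) :
    Runs reject s.store { s with cl := [], flag := true :: s.flag, j1 := [], j2 := [] }.store
      (selCost o a b c) := by
  have e1 : Runs (clear .cl) s.store { s with cl := [] }.store (2 * o + 1) :=
    runs_clear_of s (by simp) (by simp [hc])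
  have e2 : Runs (push UR.flag true) { s with cl := [] }.store
      { s with cl := [], flag := true :: s.flag }.store 1 := Runs.push' (by simp)
  have e3 := runs_sel0 { s with cl := [], flag := true :: s.flag } h1 h2
  have _ := ha
  exact (e1.seq (e2.seq e3)).mono (by unfold selCost; omega)

/-- `doPush b`: with `ne = 1ᵈ` (`d = 0` iff the register is the pass register), `cl = 1ᵒ`.
[folklore] -/
theorem runs_doPush (bit : Bool) (s : USt) {d o b c : ℕ} (hne : s.ne = un d) (hc : s.cl = un o)
    (h1 : s.j1 = un b) (h2 : s.j2 = un c) :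
    Runs (doPush bit) s.store
      { s with ne := [], wk := (if d = 0 then bit :: s.wk else s.wk), j1 := [], j2 := [], cl := [] }.store
      (2 * d + 3 + ((2 * b + 1) + (2 * c + 1)) + (2 * o + 1)) := by
  unfold doPush
  rcases Nat.eq_zero_or_pos d with rfl | hd
  · have e1 : Runs (pop UR.ne fun o => match o with
        | none => push UR.wk bit
        | some _ => clear UR.ne) s.store { s with ne := [], wk := bit :: s.wk }.store (1 + 2) :=
      Runs.pop_nil (by simp [hne]) (Runs.push' (by simp [hne]))
    have e2 := runs_sel0 { s with ne := [], wk := bit :: s.wk } h1 h2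
    have e3 : Runs (clear .cl) { s with ne := [], wk := bit :: s.wk, j1 := [], j2 := [] }.store
        { s with ne := [], wk := bit :: s.wk, j1 := [], j2 := [], cl := [] }.store (2 * o + 1) :=
      runs_clear_of _ (by simp) (by simp [hc])
    exact (e1.seq (e2.seq e3)).of_eq (by simp) (by omega)
  · obtain ⟨d, rfl⟩ : ∃ d', d = d' + 1 := ⟨d - 1, by omega⟩
    have e1 : Runs (pop UR.ne fun o => match o with
        | none => push UR.wk bit
        | some _ => clear UR.ne) s.store { s with ne := [] }.store ((2 * d + 1) + 2) :=
      Runs.pop_cons (f := fun o => match o with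
        | none => push UR.wk bit
        | some _ => clear UR.ne) (a := true) (w := un d) (by simp [hne, un, List.replicate_succ])
        ((runs_clear (Γ := Bool) UR.ne _).of_eq (by simp) (by simp))
    have e2 := runs_sel0 { s with ne := [] } h1 h2
    have e3 : Runs (clear .cl) { s with ne := [], j1 := [], j2 := [] }.store
        { s with ne := [], j1 := [], j2 := [], cl := [] }.store (2 * o + 1) :=
      runs_clear_of _ (by simp) (by simp [hc])
    exact (e1.seq (e2.seq e3)).of_eq (by simp) (by omega)

/-- `trustSel`: select by the trusted claim `cl = 1ᵒ`. [folklore] -/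
theorem runs_trustSel (s : USt) {o a b c : ℕ} (hc : s.cl = un o) (h0 : s.j0 = un a) (h1 : s.j1 = un b)
    (h2 : s.j2 = un c) :
    Runs trustSel s.store { s with cl := [], j0 := un (selv o a b c), j1 := [], j2 := [] }.store
      (selCost o a b c) := by
  unfold trustSel selCost
  rcases o with _ | _ | o
  · -- `o = 0`: `cl` empty, keep `j0`
    have e := runs_sel0 s h1 h2
    refine (Runs.pop_nil (by simp [hc]) e).of_eq ?_ (by omega)
    simp [selv, hc, h0]
  · -- `o = 1`
    have e : Runs (trustSel2 none) { s with cl := [] }.store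
        { s with cl := [], j0 := un b, j1 := [], j2 := [] }.store _ := runs_sel1 { s with cl := [] } h0 h1 h2
    have e' : Runs (trustSel1 (some true)) { s with cl := [] }.store
        { s with cl := [], j0 := un b, j1 := [], j2 := [] }.store _ := Runs.pop_nil (by simp) e
    refine (Runs.pop_cons' (f := trustSel1) (a := true) (w := []) (by simp [hc]) (by simp) e').of_eq
      ?_ (by omega)
    simp [selv]
  · -- `o ≥ 2`
    have e3 : Runs (trustSel2 (some true)) { s with cl := un o }.store
        { s with cl := [], j0 := un c, j1 := [], j2 := [] }.store ((2 * o + 1) + _) :=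
      (runs_clear_of { s with cl := un o } (by simp) (by simp)).seq
        (runs_sel2 { s with cl := [] } h0 h1 h2)
    have e2 : Runs (trustSel1 (some true)) { s with cl := true :: un o }.store
        { s with cl := [], j0 := un c, j1 := [], j2 := [] }.store _ :=
      Runs.pop_cons' (f := trustSel2) (a := true) (w := un o) (by simp) (by simp) e3
    refine (Runs.pop_cons' (f := trustSel1) (a := true) (w := true :: un o)
      (by simp [hc, un, List.replicate_succ]) (by simp) e2).of_eq ?_ (by omega)
    simp [selv]

/-- The result of checking the claim `o` against the work stack `w`: the selected target, and
whether the claim was the actual observation. [folklore] -/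
def chkTarget (o : ℕ) (w : List Bool) (a b c : ℕ) : ℕ := if o = UFlat.obsOf w then selv o a b c else a

/-- `checkSel`: pop the work stack `w`, compare the claim `1ᵒ` with the actual observation;
select the target if they agree, `reject` otherwise. [folklore] -/
theorem runs_checkSel (s : USt) (o a b c : ℕ) (w : List Bool) :
    Runs checkSel { s with wk := w, cl := un o, j0 := un a, j1 := un b, j2 := un c }.store
      { s with
          wk := w.tail, cl := [], j0 := un (chkTarget o w a b c), j1 := [], j2 := []
          flag := (if o = UFlat.obsOf w then s.flag else true :: s.flag) }.store
      (selCost o a b c + 8) := by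
  -- the stores met: `T w m` (work stack `w`, `m` claim tokens), `E w` (rejected), `F w j` (selected)
  let T : List Bool → ℕ → USt := fun w m =>
    { s with wk := w, cl := un m, j0 := un a, j1 := un b, j2 := un c }
  let E : List Bool → USt := fun w =>
    { s with wk := w, cl := [], j0 := un a, j1 := [], j2 := [], flag := true :: s.flag }
  let F : List Bool → ℕ → USt := fun w j => { s with wk := w, cl := [], j0 := un j, j1 := [], j2 := [] }
  have REJ : ∀ (w' : List Bool) (m : ℕ), m ≤ o →
      Runs reject (T w' m).store (E w').store (selCost o a b c) := by
    intro w' m hm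
    refine (runs_reject (T w' m) (o := m) rfl rfl rfl rfl).of_eq ?_ (by unfold selCost; omega)
    simp [T, E]
  have SEL0 : ∀ w', Runs sel0 (T w' 0).store (F w' a).store ((2 * b + 1) + (2 * c + 1)) :=
    fun w' => (runs_sel0 (T w' 0) rfl rfl).of_eq (by simp [T, F]) le_rfl
  have SEL1 : ∀ w', Runs sel1 (T w' 0).store (F w' b).store ((2 * a + 1) + ((3 * b + 1) + (2 * c + 1))) :=
    fun w' => (runs_sel1 (T w' 0) rfl rfl rfl).of_eq (by simp [T, F]) le_rfl
  have SEL2 : ∀ w', Runs sel2 (T w' 0).store (F w' c).store ((2 * a + 1) + ((2 * b + 1) + (3 * c + 1))) :=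
    fun w' => (runs_sel2 (T w' 0) rfl rfl rfl).of_eq (by simp [T, F]) le_rfl
  -- popping one claim token
  have hk : ∀ w' m, (T w' (m + 1)).store .cl = true :: un m := fun _ _ => by
    simp [T, un, List.replicate_succ]
  have hR : ∀ w' m, update (T w' (m + 1)).store .cl (un m) = (T w' m).store := fun _ _ => by
    simp [T]
  have hk0 : ∀ w', (T w' 0).store .cl = [] := fun _ => by simp [T]
  show Runs checkSel (T w o).store _ _
  unfold checkSel chkTarget
  rcases w with _ | ⟨_ | _, w'⟩
  · -- empty register: observation `0`
    rcases o with _ | o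
    · have e : Runs (chkTop none) (T [] 0).store (F [] a).store _ := Runs.pop_nil (hk0 _) (SEL0 [])
      refine (Runs.pop_nil (by simp [T]) e).of_eq ?_ (by unfold selCost; omega)
      simp [F, UFlat.obsOf, selv]
    · have e : Runs (chkTop none) (T [] (o + 1)).store (E []).store _ :=
        Runs.pop_cons' (f := chk0) (hk _ _) (hR _ _) (REJ [] o (by omega))
      refine (Runs.pop_nil (by simp [T]) e).of_eq ?_ (by omega)
      simp [E, UFlat.obsOf]
  · -- top `false`: observation `1`
    have hT : ∀ m, update (T (false :: w') m).store .wk w' = (T w' m).store := fun _ => by simp [T]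
    rcases o with _ | _ | o
    · have e : Runs (chkTop (some false)) (T w' 0).store (E w').store _ :=
        Runs.pop_nil (hk0 _) (REJ w' 0 le_rfl)
      refine (Runs.pop_cons' (f := chkTop) (by simp [T]) (hT _) e).of_eq ?_ (by omega)
      simp [E, UFlat.obsOf]
    · have e1 : Runs (chk1 (some true)) (T w' 0).store (F w' b).store _ := Runs.pop_nil (hk0 _) (SEL1 w')
      have e : Runs (chkTop (some false)) (T w' 1).store (F w' b).store _ :=
        Runs.pop_cons' (f := chk1) (hk _ _) (hR _ _) e1
      refine (Runs.pop_cons' (f := chkTop) (by simp [T]) (hT _) e).of_eq ?_ (by unfold selCost; omega)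
      simp [F, UFlat.obsOf, selv]
    · have e2 : Runs (chk1b (some true)) (T w' o).store (E w').store _ := REJ w' o (by omega)
      have e1 : Runs (chk1 (some true)) (T w' (o + 1)).store (E w').store _ :=
        Runs.pop_cons' (f := chk1b) (hk _ _) (hR _ _) e2
      have e : Runs (chkTop (some false)) (T w' (o + 2)).store (E w').store _ :=
        Runs.pop_cons' (f := chk1) (hk _ _) (hR _ _) e1
      refine (Runs.pop_cons' (f := chkTop) (by simp [T]) (hT _) e).of_eq ?_ (by omega)
      simp [E, UFlat.obsOf]
  · -- top `true`: observation `2`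
    have hT : ∀ m, update (T (true :: w') m).store .wk w' = (T w' m).store := fun _ => by simp [T]
    rcases o with _ | _ | _ | o
    · have e : Runs (chkTop (some true)) (T w' 0).store (E w').store _ :=
        Runs.pop_nil (hk0 _) (REJ w' 0 le_rfl)
      refine (Runs.pop_cons' (f := chkTop) (by simp [T]) (hT _) e).of_eq ?_ (by omega)
      simp [E, UFlat.obsOf]
    · have e1 : Runs (chk2 (some true)) (T w' 0).store (E w').store _ :=
        Runs.pop_nil (hk0 _) (REJ w' 0 (by omega))
      have e : Runs (chkTop (some true)) (T w' 1).store (E w').store _ :=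
        Runs.pop_cons' (f := chk2) (hk _ _) (hR _ _) e1
      refine (Runs.pop_cons' (f := chkTop) (by simp [T]) (hT _) e).of_eq ?_ (by omega)
      simp [E, UFlat.obsOf]
    · have e2 : Runs (chk2b (some true)) (T w' 0).store (F w' c).store _ := Runs.pop_nil (hk0 _) (SEL2 w')
      have e1 : Runs (chk2 (some true)) (T w' 1).store (F w' c).store _ :=
        Runs.pop_cons' (f := chk2b) (hk _ _) (hR _ _) e2
      have e : Runs (chkTop (some true)) (T w' 2).store (F w' c).store _ :=
        Runs.pop_cons' (f := chk2) (hk _ _) (hR _ _) e1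
      refine (Runs.pop_cons' (f := chkTop) (by simp [T]) (hT _) e).of_eq ?_ (by unfold selCost; omega)
      simp [F, UFlat.obsOf, selv]
    · have e3 : Runs (chk2c (some true)) (T w' o).store (E w').store _ := REJ w' o (by omega)
      have e2 : Runs (chk2b (some true)) (T w' (o + 1)).store (E w').store _ :=
        Runs.pop_cons' (f := chk2c) (hk _ _) (hR _ _) e3
      have e1 : Runs (chk2 (some true)) (T w' (o + 2)).store (E w').store _ :=
        Runs.pop_cons' (f := chk2b) (hk _ _) (hR _ _) e2
      have e : Runs (chkTop (some true)) (T w' (o + 3)).store (E w').store _ :=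
        Runs.pop_cons' (f := chk2) (hk _ _) (hR _ _) e1
      refine (Runs.pop_cons' (f := chkTop) (by simp [T]) (hT _) e).of_eq ?_ (by omega)
      simp [E, UFlat.obsOf]

/-- The mismatch count of the register comparison: `0` iff `k = p`. [folklore] -/
def mis (k p : ℕ) : ℕ := k - p + if k < p then 1 else 0

/-- `mis k p = 0 ↔ k = p`. [folklore] -/
theorem mis_eq_zero_iff (k p : ℕ) : mis k p = 0 ↔ k = p := by
  unfold mis
  by_cases h : k < p
  · rw [if_pos h]; omega
  · rw [if_neg h]; omega

/-- `mis k p ≤ k + 1`. [folklore] -/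
theorem mis_le (k p : ℕ) : mis k p ≤ k + 1 := by
  unfold mis
  have := Nat.sub_le k p
  split_ifs <;> omega

/-- `doPop` with `ne = 1ᵈ` (`d = mis k p`): trusted selection if `d ≠ 0`, checked otherwise.
[folklore] -/
theorem runs_doPop (s : USt) (d o a b c : ℕ) (w : List Bool) :
    Runs doPop { s with ne := un d, wk := w, cl := un o, j0 := un a, j1 := un b, j2 := un c }.store
      { s with
          ne := [], wk := (if d = 0 then w.tail else w), cl := []
          j0 := un (if d = 0 then chkTarget o w a b c else selv o a b c), j1 := [], j2 := []
          flag := (if d = 0 ∧ o ≠ UFlat.obsOf w then true :: s.flag else s.flag) }.store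
      (2 * d + selCost o a b c + 11) := by
  unfold doPop
  rcases d with _ | d
  · have e := runs_checkSel { s with ne := [] } o a b c w
    refine (Runs.pop_nil (by simp) (e.of_eq rfl le_rfl)).of_eq ?_ (by omega)
    by_cases ho : o = UFlat.obsOf w <;> simp [ho]
  · let X : USt := { s with ne := [], wk := w, cl := un o, j0 := un a, j1 := un b, j2 := un c }
    have e2 : Runs trustSel X.store
        { s with ne := [], wk := w, cl := [], j0 := un (selv o a b c), j1 := [], j2 := [] }.store _ :=
      (runs_trustSel X rfl rfl rfl rfl).of_eq (by simp [X]) le_rfl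
    have e1 : Runs (clear .ne) { X with ne := un d }.store X.store (2 * d + 1) :=
      runs_clear_of _ (by simp [X]) (by simp)
    have e : Runs (popBr (some true)) { X with ne := un d }.store _ _ := e1.seq e2
    refine (Runs.pop_cons' (f := popBr) (a := true) (w := un d) (by simp [un, List.replicate_succ])
      (by simp [X]) e).of_eq ?_ (by omega)
    simp

/-- The result of executing the instruction `(act, k, a, b, c)` in pass `p` on the claim `o`
with work stack `w`: the selected target, the new work stack, and whether no claim was refuted
(mirrors `UFlat.upass`). [folklore] -/
def execRes (act k p o : ℕ) (w : List Bool) (a b c : ℕ) : ℕ × List Bool × Bool :=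
  if act < 2 then (a, (if k = p then decide (act = 1) :: w else w), true)
  else if k = p then (chkTarget o w a b c, w.tail, decide (o = UFlat.obsOf w))
  else (selv o a b c, w, true)

/-- An execution changes the length of the work stack by at most one. [folklore] -/
theorem length_execRes_le (act k p o : ℕ) (w : List Bool) (a b c : ℕ) :
    (execRes act k p o w a b c).2.1.length ≤ w.length + 1 := by
  unfold execRes
  split_ifs
  all_goals simp
  all_goals omega

/-- A cost bound for `exec`. [folklore] -/
def execCost (act k o a b c : ℕ) : ℕ := 10 * k + 2 * act + 2 * o + selCost o a b c + 40

/-- **`exec` executes one instruction as pass `p` must** (`execRes`). [folklore] -/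
theorem runs_exec (s : USt) (act k p o a b c : ℕ) (w : List Bool) :
    Runs exec
      { s with
          ac := un act, kk := un k, cl := un o, j0 := un a, j1 := un b, j2 := un c
          pp := un p, pp2 := [], ne := [], wk := w }.store
      { s with
          ac := [], kk := [], cl := [], j0 := un (execRes act k p o w a b c).1, j1 := [], j2 := []
          pp := un p, pp2 := [], ne := [], wk := (execRes act k p o w a b c).2.1
          flag := (if (execRes act k p o w a b c).2.2 then s.flag else true :: s.flag) }.store
      (execCost act k o a b c) := by
  -- the store after the comparison, with `m` action tokens
  let X : ℕ → USt := fun m =>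
    { s with
        ac := un m, kk := [], cl := un o, j0 := un a, j1 := un b, j2 := un c
        pp := un p, pp2 := [], ne := un (mis k p), wk := w }
  have e0 : Runs (cmpUnary .kk .pp .pp2 .ne ;; pour .pp2 .pp) _ (X act).store (8 * k + 6) :=
    (runs_cmpPP_kk { s with
        ac := un act, kk := un k, cl := un o, j0 := un a, j1 := un b, j2 := un c
        pp := un p, pp2 := [], ne := [], wk := w } rfl rfl rfl).of_eq (by simp [X, mis]) le_rfl
  unfold exec execCost execRes
  have hd := mis_eq_zero_iff k p
  have hdle := mis_le k p
  -- the push branches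
  have PUSH : ∀ (bit : Bool), Runs (doPush bit) { (X act) with ac := [] }.store
      { s with
          ac := [], kk := [], cl := [], j0 := un a, j1 := [], j2 := []
          pp := un p, pp2 := [], ne := [], wk := (if k = p then bit :: w else w) }.store
      (2 * mis k p + 3 + ((2 * b + 1) + (2 * c + 1)) + (2 * o + 1)) := fun bit => by
    refine (runs_doPush bit { (X act) with ac := [] } (d := mis k p) (o := o) rfl rfl rfl rfl).of_eq
      ?_ le_rfl
    by_cases hkp : k = p
    · simp [X, hkp, (mis_eq_zero_iff p p).2 rfl]
    · have : mis k p ≠ 0 := fun h => hkp (hd.1 h)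
      simp [X, hkp, this]
  rcases act with _ | _ | act
  · -- `act = 0`: push `false`
    have e1 : Runs (execBr1 none) (X 0).store _ _ := (PUSH false).of_eq rfl le_rfl
    refine Runs.of_eq (e0.seq (Runs.pop_nil ?_ e1)) ?_ ?_
    · simp [X]
    · simp
    · unfold selCost; omega
  · -- `act = 1`: push `true`
    have e2 : Runs (execBr2 none) { (X 1) with ac := [] }.store _ _ := PUSH true
    have e1 : Runs (execBr1 (some true)) { (X 1) with ac := [] }.store _ _ :=
      Runs.pop_nil (by simp [X]) e2
    refine Runs.of_eq (e0.seq (Runs.pop_cons' (f := execBr1) (a := true) (w := []) ?_ ?_ e1)) ?_ ?_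
    · simp [X]
    · simp [X]
    · simp
    · unfold selCost; omega
  · -- `act ≥ 2`: pop
    have e3 := runs_doPop { s with ac := [], kk := [], pp := un p, pp2 := [] } (mis k p) o a b c w
    have e2 : Runs (clear .ac) (X act).store
        { s with
            ac := [], kk := [], cl := un o, j0 := un a, j1 := un b, j2 := un c
            pp := un p, pp2 := [], ne := un (mis k p), wk := w }.store (2 * act + 1) :=
      runs_clear_of _ (by simp [X]) (by simp [X])
    have e23 : Runs (execBr2 (some true)) (X act).store _ _ := e2.seq e3
    have e1 : Runs (execBr1 (some true)) (X (act + 1)).store _ _ :=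
      Runs.pop_cons' (f := execBr2) (a := true) (w := un act) (by simp [X, un, List.replicate_succ])
        (by simp [X]) e23
    refine Runs.of_eq (e0.seq (Runs.pop_cons' (f := execBr1) (a := true) (w := un (act + 1)) ?_ ?_ e1))
      ?_ ?_
    · simp [X, un, List.replicate_succ]
    · simp [X]
    · have hlt : ¬ (act + 1 + 1 < 2) := by omega
      by_cases hkp : k = p
      · subst hkp
        have h0 : mis k k = 0 := (mis_eq_zero_iff k k).2 rfl
        by_cases ho : o = UFlat.obsOf w <;> simp [h0, ho, hlt]
      · have h0 : mis k p ≠ 0 := fun h => hkp (hd.1 h)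
        simp [h0, hkp, hlt]
    · omega

/-! ### The code register: instruction encoding and the cursor -/

/-- The unary block of `n`: `1ⁿ 0`. [folklore] -/
def blk (n : ℕ) : List Bool := un n ++ [false]

/-- The encoding of a uniform instruction: five blocks. [folklore] -/
def encInstr (i : UFlat.UInstr) : List Bool := blk i.act ++ blk i.k ++ blk i.j0 ++ blk i.j1 ++ blk i.j2

/-- The encoding of a uniform program. [folklore] -/
def encProg (P : UFlat.UProg) : List Bool := (P.map encInstr).flatten

/-- The size of an instruction (sum of its fields). [folklore] -/
def isize (i : UFlat.UInstr) : ℕ := i.act + i.k + i.j0 + i.j1 + i.j2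

/-- Length of an encoded instruction. [folklore] -/
@[simp] theorem length_encInstr (i : UFlat.UInstr) : (encInstr i).length = isize i + 5 := by
  simp [encInstr, blk, isize]; omega

/-- The code register at cursor `pc`: the encodings of the instructions from `pc` on (empty at or
beyond the end). [folklore] -/
def codeAt (P : UFlat.UProg) (pc : ℕ) : List Bool := encProg (P.drop pc)

/-- The consumed-code register at cursor `pc`: the encodings of the first `pc` instructions,
reversed. [folklore] -/
def codeLAt (P : UFlat.UProg) (pc : ℕ) : List Bool := (encProg (P.take pc)).reverse

/-- `encProg` of a cons. [folklore] -/
theorem encProg_cons (i : UFlat.UInstr) (P : UFlat.UProg) : encProg (i :: P) = encInstr i ++ encProg P := by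
  simp [encProg]

/-- `encProg` of an append. [folklore] -/
theorem encProg_append (P Q : UFlat.UProg) : encProg (P ++ Q) = encProg P ++ encProg Q := by
  simp [encProg]

/-- The code register inside the program starts with the current instruction. [folklore] -/
theorem codeAt_eq_of_lt {P : UFlat.UProg} {pc : ℕ} (h : pc < P.length) :
    codeAt P pc = encInstr P[pc] ++ codeAt P (pc + 1) := by
  rw [codeAt, codeAt, List.drop_eq_getElem_cons h, encProg_cons]

/-- The code register at or beyond the end is empty. [folklore] -/
theorem codeAt_eq_nil_of_le {P : UFlat.UProg} {pc : ℕ} (h : P.length ≤ pc) : codeAt P pc = [] := by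
  rw [codeAt, List.drop_eq_nil_of_le h]; rfl

/-- Advancing the consumed-code register by one instruction. [folklore] -/
theorem codeLAt_succ {P : UFlat.UProg} {pc : ℕ} (h : pc < P.length) :
    codeLAt P (pc + 1) = (encInstr P[pc]).reverse ++ codeLAt P pc := by
  rw [codeLAt, codeLAt, List.take_succ_eq_append_getElem h, encProg_append, List.reverse_append]
  simp [encProg]

/-- Beyond the end the consumed-code register no longer changes. [folklore] -/
theorem codeLAt_succ_of_le {P : UFlat.UProg} {pc : ℕ} (h : P.length ≤ pc) :
    codeLAt P (pc + 1) = codeLAt P pc := by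
  rw [codeLAt, codeLAt, List.take_of_length_le h, List.take_of_length_le (by omega)]

/-- Rewinding: the consumed code poured back gives the whole program. [folklore] -/
theorem reverse_codeLAt_append_codeAt (P : UFlat.UProg) (pc : ℕ) :
    (codeLAt P pc).reverse ++ codeAt P pc = codeAt P 0 := by
  rw [codeLAt, List.reverse_reverse, codeAt, codeAt, List.drop_zero, ← encProg_append, List.take_append_drop]

/-- `codeLAt P 0 = []`. [folklore] -/
@[simp] theorem codeLAt_zero (P : UFlat.UProg) : codeLAt P 0 = [] := by simp [codeLAt, encProg]

/-- A reversed block on top of a word. [folklore] -/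
theorem reverse_blk (n : ℕ) (l : List Bool) : (blk n).reverse ++ l = [false] ++ un n ++ l := by
  simp [blk, un]

/-! ### Fetching and skipping instructions -/

/-- A cost bound for `fetch`/`skip1` on an instruction. [folklore] -/
def fetchCost (i : UFlat.UInstr) : ℕ := 7 * isize i + 35

/-- One block move from `code` to `codeL` on named stores, block form. [folklore] -/
theorem runs_moveBlk (cnt : UR) (g1 : cnt ≠ .code) (g2 : cnt ≠ .codeL) (g3 : cnt ≠ .w) (S : USt) (a : ℕ)
    (r cL : List Bool) (hSw : S.w = []) :
    Runs (moveBlock .code .codeL cnt .w) { S with code := blk a ++ r, codeL := cL }.store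
      (update { S with code := r, codeL := [false] ++ un a ++ cL }.store cnt (un a ++ S.store cnt))
      (7 * a + 7) := by
  have h := runs_moveBlock_code cnt g1 g2 g3 { S with code := blk a ++ r, codeL := cL } (a := a)
    (t := false :: r) (Or.inr ⟨r, rfl⟩) (by simp [blk]) hSw
  refine h.of_eq ?_ le_rfl
  cases cnt <;> simp at g1 g2 g3 ⊢

/-- **`fetch`** at a cursor inside the program: the current instruction moves to `codeL` and its
fields are counted on `ac, kk, j0, j1, j2` (all empty before). [folklore] -/
theorem runs_fetch (s : USt) (i : UFlat.UInstr) (rest cl : List Bool) (hw : s.w = []) :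
    Runs fetch { s with code := encInstr i ++ rest, codeL := cl, ac := [], kk := [], j0 := [], j1 := [], j2 := [] }.store
      { s with
          code := rest, codeL := (encInstr i).reverse ++ cl
          ac := un i.act, kk := un i.k, j0 := un i.j0, j1 := un i.j1, j2 := un i.j2 }.store
      (fetchCost i) := by
  -- the base store with the five counters prescribed
  let B : ℕ → ℕ → ℕ → ℕ → ℕ → List Bool → List Bool → USt := fun a k x y z cd cL =>
    { s with code := cd, codeL := cL, ac := un a, kk := un k, j0 := un x, j1 := un y, j2 := un z }
  have hB : ∀ a k x y z cd cL, (B a k x y z cd cL).w = [] := fun _ _ _ _ _ _ _ => hw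
  unfold fetch fetchCost
  have start : ({ s with
      code := encInstr i ++ rest, codeL := cl, ac := [], kk := [], j0 := [], j1 := [], j2 := [] } : USt).store =
      (B 0 0 0 0 0 (blk i.act ++ (blk i.k ++ (blk i.j0 ++ (blk i.j1 ++ (blk i.j2 ++ rest))))) cl).store := by
    simp [B, encInstr, List.append_assoc]
  rw [start]
  have e1 := runs_moveBlk .ac (by decide) (by decide) (by decide) (B 0 0 0 0 0 [] cl) i.act
    (blk i.k ++ (blk i.j0 ++ (blk i.j1 ++ (blk i.j2 ++ rest)))) cl (hB ..)
  have e2 := runs_moveBlk .kk (by decide) (by decide) (by decide) (B i.act 0 0 0 0 [] []) i.k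
    (blk i.j0 ++ (blk i.j1 ++ (blk i.j2 ++ rest))) ([false] ++ un i.act ++ cl) (hB ..)
  have e3 := runs_moveBlk .j0 (by decide) (by decide) (by decide) (B i.act i.k 0 0 0 [] []) i.j0
    (blk i.j1 ++ (blk i.j2 ++ rest)) ([false] ++ un i.k ++ ([false] ++ un i.act ++ cl)) (hB ..)
  have e4 := runs_moveBlk .j1 (by decide) (by decide) (by decide) (B i.act i.k i.j0 0 0 [] []) i.j1
    (blk i.j2 ++ rest) ([false] ++ un i.j0 ++ ([false] ++ un i.k ++ ([false] ++ un i.act ++ cl))) (hB ..)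
  have e5 := runs_moveBlk .j2 (by decide) (by decide) (by decide) (B i.act i.k i.j0 i.j1 0 [] []) i.j2 rest
    ([false] ++ un i.j1 ++ ([false] ++ un i.j0 ++ ([false] ++ un i.k ++ ([false] ++ un i.act ++ cl)))) (hB ..)
  simp only [B, update_store_ac, update_store_kk, update_store_j0, update_store_j1, update_store_j2,
    store_ac, store_kk, store_j0, store_j1, store_j2, List.append_nil, un, List.replicate_zero] at e1 e2 e3 e4 e5 ⊢
  refine Runs.of_eq (e1.seq (e2.seq (e3.seq (e4.seq e5)))) ?_ ?_
  · simp [encInstr, blk, un]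
  · simp [isize]; omega

/-- **`skip1`** at a cursor inside the program: the current instruction moves to `codeL`.
[folklore] -/
theorem runs_skip1 (s : USt) (i : UFlat.UInstr) (rest cl : List Bool) (hw : s.w = []) :
    Runs skip1 { s with code := encInstr i ++ rest, codeL := cl, t1 := [] }.store
      { s with code := rest, codeL := (encInstr i).reverse ++ cl, t1 := [] }.store (9 * isize i + 36) := by
  let B : ℕ → List Bool → List Bool → USt := fun n cd cL => { s with code := cd, codeL := cL, t1 := un n }
  have hB : ∀ n cd cL, (B n cd cL).w = [] := fun _ _ _ => hw
  unfold skip1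
  have start : ({ s with code := encInstr i ++ rest, codeL := cl, t1 := [] } : USt).store =
      (B 0 (blk i.act ++ (blk i.k ++ (blk i.j0 ++ (blk i.j1 ++ (blk i.j2 ++ rest))))) cl).store := by
    simp [B, encInstr, List.append_assoc]
  rw [start]
  have e1 := runs_moveBlk .t1 (by decide) (by decide) (by decide) (B 0 [] []) i.act
    (blk i.k ++ (blk i.j0 ++ (blk i.j1 ++ (blk i.j2 ++ rest)))) cl (hB ..)
  have e2 := runs_moveBlk .t1 (by decide) (by decide) (by decide) (B i.act [] []) i.k
    (blk i.j0 ++ (blk i.j1 ++ (blk i.j2 ++ rest))) ([false] ++ un i.act ++ cl) (hB ..)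
  have e3 := runs_moveBlk .t1 (by decide) (by decide) (by decide) (B (i.k + i.act) [] []) i.j0
    (blk i.j1 ++ (blk i.j2 ++ rest)) ([false] ++ un i.k ++ ([false] ++ un i.act ++ cl)) (hB ..)
  have e4 := runs_moveBlk .t1 (by decide) (by decide) (by decide) (B (i.j0 + (i.k + i.act)) [] []) i.j1
    (blk i.j2 ++ rest) ([false] ++ un i.j0 ++ ([false] ++ un i.k ++ ([false] ++ un i.act ++ cl))) (hB ..)
  have e5 := runs_moveBlk .t1 (by decide) (by decide) (by decide) (B (i.j1 + (i.j0 + (i.k + i.act))) [] [])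
    i.j2 rest ([false] ++ un i.j1 ++ ([false] ++ un i.j0 ++ ([false] ++ un i.k ++ ([false] ++ un i.act ++ cl))))
    (hB ..)
  simp only [B, update_store_t1, store_t1, List.append_nil, un, List.replicate_zero,
    ← List.replicate_add] at e1 e2 e3 e4 e5 ⊢
  have e6 : Runs (clear .t1)
      (B (i.j2 + (i.j1 + (i.j0 + (i.k + i.act)))) rest
        ([false] ++ un i.j2 ++ ([false] ++ un i.j1 ++ ([false] ++ un i.j0 ++ ([false] ++ un i.k ++
          ([false] ++ un i.act ++ cl)))))).store
      (B 0 rest ([false] ++ un i.j2 ++ ([false] ++ un i.j1 ++ ([false] ++ un i.j0 ++ ([false] ++ un i.k ++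
          ([false] ++ un i.act ++ cl)))))).store (2 * (i.j2 + (i.j1 + (i.j0 + (i.k + i.act)))) + 1) :=
    runs_clear_of _ (by simp [B, un]) (by simp [B])
  simp only [B, un, List.replicate_zero] at e6
  refine Runs.of_eq (e1.seq (e2.seq (e3.seq (e4.seq (e5.seq e6))))) ?_ ?_
  · simp [encInstr, blk, un]
  · simp [isize]; omega

/-- **`skip1`** at the end of the program changes nothing (`36` steps). [folklore] -/
theorem runs_skip1_nil (s : USt) (cl : List Bool) (hw : s.w = []) :
    Runs skip1 { s with code := [], codeL := cl, t1 := [] }.store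
      { s with code := [], codeL := cl, t1 := [] }.store 36 := by
  have M : Runs (moveBlock .code .codeL .t1 .w) { s with code := [], codeL := cl, t1 := [] }.store
      { s with code := [], codeL := cl, t1 := [] }.store 7 := by
    have h := runs_moveBlock_code .t1 (by decide) (by decide) (by decide)
      { s with code := [], codeL := cl, t1 := [] } (a := 0) (t := []) (Or.inl rfl) (by simp) hw
    exact h.of_eq (by simp) le_rfl
  have C : Runs (clear .t1) { s with code := [], codeL := cl, t1 := [] }.store
      { s with code := [], codeL := cl, t1 := [] }.store (2 * 0 + 1) :=
    runs_clear_of { s with code := [], codeL := cl, t1 := [] } (by simp) (by simp)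
  exact (M.seq (M.seq (M.seq (M.seq (M.seq C))))).mono (by norm_num)

/-- **Skipping `j` instructions**: `loop j0 skip1` advances the cursor from `pc` to `pc + j` (the
code registers saturate beyond the end), within `9 |code| + 38 j + 1` steps. [folklore] -/
theorem runs_skip (P : UFlat.UProg) (s : USt) (hw : s.w = []) : ∀ (j pc : ℕ),
    Runs (loop .j0 fun _ => skip1)
      { s with code := codeAt P pc, codeL := codeLAt P pc, j0 := un j, t1 := [] }.store
      { s with code := codeAt P (pc + j), codeL := codeLAt P (pc + j), j0 := [], t1 := [] }.store
      (9 * (codeAt P pc).length + 38 * j + 1)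
  | 0, pc => (Runs.loop_nil _ (by simp)).mono (by omega)
  | j + 1, pc => by
    by_cases hpc : pc < P.length
    · have e1 := runs_skip1 { s with j0 := un j } P[pc] (codeAt P (pc + 1)) (codeLAt P pc) hw
      have ih := runs_skip P s hw j (pc + 1)
      rw [← codeLAt_succ hpc] at e1
      rw [show pc + 1 + j = pc + (j + 1) by omega] at ih
      have h := Runs.loop_cons' (k := UR.j0) (f := fun _ => skip1) (a := true) (w := un j)
        (R := { s with code := codeAt P pc, codeL := codeLAt P pc, j0 := un (j + 1), t1 := [] }.store)
        (by simp [un, List.replicate_succ]) (by simp [codeAt_eq_of_lt hpc]) (e1.of_eq (by simp) le_rfl) ih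
      refine h.of_eq rfl ?_
      rw [codeAt_eq_of_lt hpc, List.length_append, length_encInstr]
      omega
    · have hle : P.length ≤ pc := Nat.le_of_not_lt hpc
      have e1 := runs_skip1_nil { s with j0 := un j } (codeLAt P pc) hw
      have ih := runs_skip P s hw j (pc + 1)
      rw [show pc + 1 + j = pc + (j + 1) by omega, codeAt_eq_nil_of_le (show P.length ≤ pc + 1 by omega),
        codeLAt_succ_of_le hle] at ih
      have hcd : codeAt P pc = [] := codeAt_eq_nil_of_le hle
      have h := Runs.loop_cons' (k := UR.j0) (f := fun _ => skip1) (a := true) (w := un j)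
        (R := { s with code := codeAt P pc, codeL := codeLAt P pc, j0 := un (j + 1), t1 := [] }.store)
        (by simp [un, List.replicate_succ]) (by simp [hcd]) (e1.of_eq (by simp) le_rfl) ih
      refine h.of_eq rfl ?_
      simp [hcd]
      omega

/-! ### One simulated step -/

/-- The store of pass `p` at cursor `pc` with work stack `w`, claim `1ᵒ` pending and all
scratch registers clean. [folklore] -/
def stepSt (s : USt) (P : UFlat.UProg) (pc p : ℕ) (w : List Bool) (o : ℕ) : USt :=
  { s with
      code := codeAt P pc, codeL := codeLAt P pc, cl := un o, pp := un p, pp2 := [], ne := [], wk := w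
      ac := [], kk := [], j0 := [], j1 := [], j2 := [], t1 := [] }

/-- A cost bound for one simulated step on a claim `o`. [folklore] -/
def stepCost (P : UFlat.UProg) (o : ℕ) : ℕ := 70 * (encProg P).length + 4 * o + 120

/-- An instruction is no longer than the program containing it. [folklore] -/
theorem length_encInstr_le {P : UFlat.UProg} {pc : ℕ} (h : pc < P.length) :
    (encInstr P[pc]).length ≤ (encProg P).length := by
  have := congrArg List.length (reverse_codeLAt_append_codeAt P pc)
  rw [codeAt_eq_of_lt h] at this
  simp only [List.length_append, List.length_reverse, codeAt, List.drop_zero] at this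
  omega

/-- The code registers are no longer than the program. [folklore] -/
theorem length_codeLAt_add (P : UFlat.UProg) (pc : ℕ) :
    (codeLAt P pc).length + (codeAt P pc).length = (encProg P).length := by
  have := congrArg List.length (reverse_codeLAt_append_codeAt P pc)
  simpa [codeAt] using this

/-- **`step`, halted cursor**: the claim is discarded, nothing else changes. [folklore] -/
theorem runs_step_halted (s : USt) (P : UFlat.UProg) {pc : ℕ} (hpc : P.length ≤ pc) (p : ℕ)
    (w : List Bool) (o : ℕ) :
    Runs step (stepSt s P pc p w o).store (stepSt s P pc p w 0).store (2 * o + 3) := by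
  unfold step
  have hcd : codeAt P pc = [] := codeAt_eq_nil_of_le hpc
  have e : Runs (stepBr none) (stepSt s P pc p w o).store (stepSt s P pc p w 0).store (2 * o + 1) :=
    runs_clear_of _ (by simp [stepSt]) (by simp [stepSt])
  exact Runs.pop_nil (by simp [stepSt, hcd]) e

/-- Changing the initial store of a run along an equation. [folklore] -/
theorem _root_.Literature.Computability.Complexity.ACom.Runs.start {c : Prog} {R R₀ R' : Store} {B : ℕ}
    (h : Runs c R R' B) (e : R = R₀) : Runs c R₀ R' B := e ▸ h

/-- **`step` inside the program executes the current instruction as pass `p` must**: the cursor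
moves to the selected target, the work stack and `flag` change as `execRes` prescribes, and all
scratch registers are clean again. [folklore] -/
theorem runs_step (s : USt) (hw : s.w = []) (P : UFlat.UProg) {pc : ℕ} (hpc : pc < P.length) (p : ℕ)
    (w : List Bool) (o : ℕ) :
    Runs step (stepSt s P pc p w o).store
      (stepSt { s with flag := (if (execRes P[pc].act P[pc].k p o w P[pc].j0 P[pc].j1 P[pc].j2).2.2
          then s.flag else true :: s.flag) } P
        (execRes P[pc].act P[pc].k p o w P[pc].j0 P[pc].j1 P[pc].j2).1 p
        (execRes P[pc].act P[pc].k p o w P[pc].j0 P[pc].j1 P[pc].j2).2.1 0).store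
      (stepCost P o) := by
  set i := P[pc] with hi
  set r := execRes i.act i.k p o w i.j0 i.j1 i.j2 with hr
  have hcd : codeAt P pc = encInstr i ++ codeAt P (pc + 1) := codeAt_eq_of_lt hpc
  obtain ⟨b, rest, hb⟩ : ∃ b rest, encInstr i ++ codeAt P (pc + 1) = b :: rest := by
    cases h : encInstr i ++ codeAt P (pc + 1) with
    | nil => have := congrArg List.length h; simp at this
    | cons b rest => exact ⟨b, rest, rfl⟩
  -- the stores met
  let S0 : USt := stepSt s P pc p w o
  let S1 : USt :=
    { s with
        code := codeAt P (pc + 1), codeL := codeLAt P (pc + 1), cl := un o, pp := un p, pp2 := [], ne := []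
        wk := w, ac := un i.act, kk := un i.k, j0 := un i.j0, j1 := un i.j1, j2 := un i.j2, t1 := [] }
  let S2 : USt :=
    { s with
        code := codeAt P (pc + 1), codeL := codeLAt P (pc + 1), t1 := []
        ac := [], kk := [], cl := [], j0 := un r.1, j1 := [], j2 := [], pp := un p, pp2 := [], ne := []
        wk := r.2.1, flag := (if r.2.2 then s.flag else true :: s.flag) }
  let S3 : USt := { S2 with code := codeAt P 0, codeL := codeLAt P 0 }
  let S4 : USt := { S2 with code := codeAt P r.1, codeL := codeLAt P r.1, j0 := [] }
  -- push back the probed symbol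
  have e1 : Runs (push UR.code b) (update S0.store .code rest) S0.store 1 :=
    Runs.push' (by simp [S0, stepSt, hcd, hb])
  -- fetch
  have e2 : Runs fetch S0.store S1.store (fetchCost i) := by
    have h := runs_fetch { s with cl := un o, pp := un p, pp2 := [], ne := [], wk := w, t1 := [] } i
      (codeAt P (pc + 1)) (codeLAt P pc) hw
    refine (h.start ?_).of_eq ?_ le_rfl
    · simp [S0, stepSt, hcd]
    · simp [S1, codeLAt_succ hpc, hi]
  -- execute
  have e3 : Runs exec S1.store S2.store (execCost i.act i.k o i.j0 i.j1 i.j2) := by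
    have h := runs_exec { s with code := codeAt P (pc + 1), codeL := codeLAt P (pc + 1), t1 := [] }
      i.act i.k p o i.j0 i.j1 i.j2 w
    rw [← hr] at h
    exact h
  -- rewind
  have e4 : Runs (pour .codeL .code) S2.store S3.store (3 * (codeLAt P (pc + 1)).length + 1) :=
    runs_pour_of (by decide) _ (by simp [S2, S3, reverse_codeLAt_append_codeAt]) (by simp [S2])
  -- skip to the target
  have e5 : Runs (loop .j0 fun _ => skip1) S3.store S4.store (9 * (codeAt P 0).length + 38 * r.1 + 1) := by
    have h := runs_skip P { s with
      t1 := [], ac := [], kk := [], cl := [], j1 := [], j2 := [], pp := un p, pp2 := [], ne := []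
      wk := r.2.1, flag := (if r.2.2 then s.flag else true :: s.flag) } hw r.1 0
    rw [Nat.zero_add] at h
    exact h
  unfold step
  refine Runs.of_eq (Runs.pop_cons' (f := stepBr) (a := b) (w := rest) (by simp [stepSt, hcd, hb]) rfl
    (e1.seq (e2.seq (e3.seq (e4.seq e5))))) ?_ ?_
  · simp [S4, S2, stepSt]
  · -- the cost
    have hl1 := length_encInstr_le hpc
    have hl2 := length_codeLAt_add P (pc + 1)
    have hl3 : (codeAt P 0).length = (encProg P).length := by simp [codeAt]
    rw [← hi] at hl1
    have hr1 : r.1 ≤ isize i := by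
      simp only [hr, execRes, chkTarget, selv]
      split_ifs <;> simp [isize] <;> omega
    have hli : (encInstr i).length = isize i + 5 := length_encInstr i
    simp only [fetchCost, execCost, selCost, stepCost, isize] at hr1 hli ⊢
    omega

/-! ### Records -/

/-- The claim records of a copy: `1 (1^{o₁} 0) 1 (1^{o₂} 0) …`. [folklore] -/
def encBody (os : List ℕ) : List Bool := os.flatMap fun o => true :: blk o

/-- The claim copy: the records followed by the terminator `0`. [folklore] -/
def encClaims (os : List ℕ) : List Bool := encBody os ++ [false]

/-- `encBody (o :: os)`. [folklore] -/
theorem encBody_cons (o : ℕ) (os : List ℕ) : encBody (o :: os) = true :: (blk o ++ encBody os) := by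
  simp [encBody]

/-- The store of the record loop: program `P` at cursor `pc`, pass `p`, work stack `w`, `fl` flag
tokens, transcript rest `tr`, consumed copy `cu` (reversed), remaining copy `cu2`, loop token
`wr`; yardsticks `1^Y` and `1^K`; scratch registers clean. [folklore] -/
def recSt (s : USt) (P : UFlat.UProg) (Y K pc p : ℕ) (w : List Bool) (fl : ℕ)
    (tr cu cu2 wr : List Bool) : USt :=
  { s with
      code := codeAt P pc, codeL := codeLAt P pc, pp := un p, pp2 := [], ne := [], wk := w, flag := un fl
      cl := [], ac := [], kk := [], j0 := [], j1 := [], j2 := [], t1 := [], tr := tr, cur := cu, cur2 := cu2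
      yard := un Y, yard2 := [], ky := un K, ky2 := [], wr := wr }

/-- **A record in skipping mode** (`flag` raised): the claim is parsed and discarded.
[folklore] -/
theorem runs_rec_skip (s : USt) (hw : s.w = []) (P : UFlat.UProg) (Y K pc p : ℕ) (w : List Bool)
    (fl : ℕ) (tr cu rest : List Bool) (o : ℕ) :
    Runs (pop .cur2 recBody) (recSt s P Y K pc p w (fl + 1) tr cu (true :: (blk o ++ rest)) []).store
      (recSt s P Y K pc p w (fl + 1) tr ([false] ++ un o ++ true :: cu) rest [true]).store (9 * o + 15) := by
  -- the stores met
  let A2 : USt := recSt s P Y K pc p w (fl + 1) tr (true :: cu) (blk o ++ rest) []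
  let A4 : USt := { A2 with cur2 := rest, cur := [false] ++ un o ++ true :: cu, cl := un o }
  let A5 : USt := recSt s P Y K pc p w (fl + 1) tr ([false] ++ un o ++ true :: cu) rest []
  have e1 : Runs (push UR.cur true) (recSt s P Y K pc p w (fl + 1) tr cu (blk o ++ rest) []).store
      A2.store 1 := Runs.push' (by simp [A2, recSt])
  have e4 : Runs (moveBlock .cur2 .cur .cl .w) A2.store A4.store (7 * o + 7) := by
    have h := runs_moveBlock_cur2 A2 (a := o) (t := false :: rest) (Or.inr ⟨rest, rfl⟩)
      (by simp [A2, recSt, blk]) (by simpa [A2, recSt] using hw)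
    exact h.of_eq (by simp [A2, A4, recSt]) le_rfl
  have e5 : Runs (clear .cl) A4.store A5.store (2 * o + 1) :=
    runs_clear_of A4 (by simp [A4, A5, A2, recSt]) (by simp [A4])
  have e3 : Runs (ifFlagBr recSkip recWork (some true)) { A2 with flag := un fl }.store A5.store
      (1 + ((7 * o + 7) + (2 * o + 1))) :=
    (Runs.push' (by simp [A2, recSt, un, List.replicate_succ])).seq (e4.seq e5)
  have e2 : Runs (ifFlag recSkip recWork) A2.store A5.store (1 + ((7 * o + 7) + (2 * o + 1)) + 2) :=
    Runs.pop_cons' (f := ifFlagBr recSkip recWork) (a := true) (w := un fl)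
      (by simp [A2, recSt, un, List.replicate_succ]) (by simp [A2]) e3
  have e6 : Runs (push UR.wr true) A5.store
      (recSt s P Y K pc p w (fl + 1) tr ([false] ++ un o ++ true :: cu) rest [true]).store 1 :=
    Runs.push' (by simp [A5, recSt])
  refine Runs.of_eq (Runs.pop_cons' (f := recBody) (a := true) (w := blk o ++ rest) (by simp [recSt])
    (by simp [recSt]) (e1.seq (e2.seq e6))) rfl (by omega)

/-- **The terminator record**: the loop ends. [folklore] -/
theorem runs_rec_end (s : USt) (P : UFlat.UProg) (Y K pc p : ℕ) (w : List Bool) (fl : ℕ)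
    (tr cu rest : List Bool) :
    Runs (pop .cur2 recBody) (recSt s P Y K pc p w fl tr cu (false :: rest) []).store
      (recSt s P Y K pc p w fl tr (false :: cu) rest []).store 3 :=
  Runs.pop_cons' (f := recBody) (a := false) (w := rest) (by simp [recSt]) rfl
    (Runs.push' (by simp [recSt]))

/-- `execRes` is one pass step of `FlatTranscripts.lean` inside the program. [folklore] -/
theorem upass_eq_execRes {P : UFlat.UProg} {pc : ℕ} (hpc : pc < P.length) (p o : ℕ) (w : List Bool) :
    UFlat.upass P p (pc, w) o =
      (if (execRes P[pc].act P[pc].k p o w P[pc].j0 P[pc].j1 P[pc].j2).2.2 then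
        some ((execRes P[pc].act P[pc].k p o w P[pc].j0 P[pc].j1 P[pc].j2).1,
          (execRes P[pc].act P[pc].k p o w P[pc].j0 P[pc].j1 P[pc].j2).2.1)
      else none) := by
  unfold UFlat.upass execRes chkTarget selv UFlat.UInstr.sel
  rw [List.getElem?_eq_getElem hpc]
  simp only
  by_cases ha : P[pc].act < 2
  · simp [ha]
  · simp only [if_neg ha]
    by_cases hk : P[pc].k = p
    · simp only [if_pos hk]
      by_cases ho : o = UFlat.obsOf w
      · simp [ho]
      · simp [ho]
    · simp [hk]

/-- A halted pass step changes nothing. [folklore] -/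
theorem upass_of_le {P : UFlat.UProg} {pc : ℕ} (hpc : P.length ≤ pc) (p o : ℕ) (w : List Bool) :
    UFlat.upass P p (pc, w) o = some (pc, w) := by
  unfold UFlat.upass
  rw [List.getElem?_eq_none_iff.2 hpc]

/-- The work stack grows by at most one symbol per pass step. [folklore] -/
theorem length_le_of_upass {P : UFlat.UProg} {p : ℕ} {c : ℕ × List Bool} {o : ℕ} {c' : ℕ × List Bool}
    (h : UFlat.upass P p c o = some c') : c'.2.length ≤ c.2.length + 1 := by
  unfold UFlat.upass at h
  split at h
  · cases h; simp
  · split_ifs at h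
    all_goals cases h
    all_goals simp
    all_goals omega

/-- A cost bound for one record in working mode. [folklore] -/
def recCost (P : UFlat.UProg) (Y K o : ℕ) : ℕ := 7 * o + 11 * Y + 11 * K + stepCost P o + 29

/-- **A record in working mode, payment sufficient**: the claim `o` is read, `Y + K` symbols are
paid, and one pass step is taken: to the new cursor and work stack if the claim passes
(`UFlat.upass … = some …`), with `flag` raised otherwise. [folklore] -/
theorem runs_rec_work (s : USt) (hw : s.w = []) (P : UFlat.UProg) (Y K pc p : ℕ) (w : List Bool)
    (tr cu rest : List Bool) (o : ℕ) (htr : Y + K ≤ tr.length) :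
    ∃ (pc' : ℕ) (w' : List Bool) (fl' : ℕ),
      Runs (pop .cur2 recBody) (recSt s P Y K pc p w 0 tr cu (true :: (blk o ++ rest)) []).store
        (recSt s P Y K pc' p w' fl' (tr.drop (Y + K)) ([false] ++ un o ++ true :: cu) rest [true]).store
        (recCost P Y K o) ∧
      ((UFlat.upass P p (pc, w) o = some (pc', w') ∧ fl' = 0) ∨ (UFlat.upass P p (pc, w) o = none ∧ fl' = 1)) ∧
      w'.length ≤ w.length + 1 := by
  -- the stores met
  let B2 : USt := recSt s P Y K pc p w 0 tr (true :: cu) (blk o ++ rest) []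
  let B4 : USt := { B2 with cur2 := rest, cur := [false] ++ un o ++ true :: cu, cl := un o }
  let B5 : USt := { B4 with tr := tr.drop Y }
  let B6 : USt := { B4 with tr := (tr.drop Y).drop K }
  let s₁ : USt :=
    { s with
        tr := (tr.drop Y).drop K, cur := [false] ++ un o ++ true :: cu, cur2 := rest
        yard := un Y, yard2 := [], ky := un K, ky2 := [], flag := [], wr := [] }
  have hs₁ : s₁.w = [] := hw
  have hB6 : B6.store = (stepSt s₁ P pc p w o).store := by simp [B6, B4, B2, s₁, recSt, stepSt]
  have e1 : Runs (push UR.cur true) (recSt s P Y K pc p w 0 tr cu (blk o ++ rest) []).store B2.store 1 :=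
    Runs.push' (by simp [B2, recSt])
  have e4 : Runs (moveBlock .cur2 .cur .cl .w) B2.store B4.store (7 * o + 7) := by
    have h := runs_moveBlock_cur2 B2 (a := o) (t := false :: rest) (Or.inr ⟨rest, rfl⟩)
      (by simp [B2, recSt, blk]) (by simpa [B2, recSt] using hw)
    exact h.of_eq (by simp [B2, B4, recSt]) le_rfl
  have e5 : Runs (pay .yard .yard2) B4.store B5.store (11 * Y + 7) :=
    (runs_pay_yard_ok B4 (n := Y) (by simp [B4, B2, recSt]) (by simp [B4, B2, recSt])
      (by simp [B4, B2, recSt]; omega) (by simpa [B4, B2, recSt] using hw)).of_eq (by simp [B4, B5, B2, recSt]) le_rfl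
  have e6 : Runs (pay .ky .ky2) B5.store B6.store (11 * K + 7) :=
    (runs_pay_ky_ok B5 (n := K) (by simp [B5, B4, B2, recSt]) (by simp [B5, B4, B2, recSt])
      (by simp [B5]; omega) (by simpa [B5, B4, B2, recSt] using hw)).of_eq
      (by simp [B5, B6, B4, B2, recSt]) le_rfl
  by_cases hpc : pc < P.length
  · -- inside the program: one genuine step
    set r := execRes P[pc].act P[pc].k p o w P[pc].j0 P[pc].j1 P[pc].j2 with hr
    refine ⟨r.1, r.2.1, if r.2.2 then 0 else 1, ?_, ?_, by rw [hr]; exact length_execRes_le ..⟩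
    · have e8 := runs_step s₁ hs₁ P hpc p w o
      rw [← hr, ← hB6] at e8
      have e7 : Runs (ifFlag (clear .cl) step) B6.store _ _ := Runs.pop_nil (by simp [B6, B4, B2, recSt]) e8
      have e9 : Runs (push UR.wr true)
          (stepSt { s₁ with flag := (if r.2.2 then s₁.flag else true :: s₁.flag) } P r.1 p r.2.1 0).store
          (recSt s P Y K r.1 p r.2.1 (if r.2.2 then 0 else 1) (tr.drop (Y + K))
            ([false] ++ un o ++ true :: cu) rest [true]).store 1 := by
        refine Runs.push' ?_
        cases r.2.2 <;> simp [s₁, stepSt, recSt, un, List.drop_drop, Nat.add_comm Y K]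
      have e3 : Runs recWork B2.store _ _ := e4.seq (e5.seq (e6.seq e7))
      have e2 : Runs (ifFlag recSkip recWork) B2.store _ _ := Runs.pop_nil (by simp [B2, recSt]) e3
      refine Runs.of_eq (Runs.pop_cons' (f := recBody) (a := true) (w := blk o ++ rest) (by simp [recSt])
        (by simp [recSt]) (e1.seq (e2.seq e9))) rfl ?_
      unfold recCost; omega
    · rw [upass_eq_execRes hpc, ← hr]
      cases r.2.2 <;> simp
  · -- halted cursor
    have hle : P.length ≤ pc := Nat.le_of_not_lt hpc
    refine ⟨pc, w, 0, ?_, Or.inl ⟨upass_of_le hle p o w, rfl⟩, by omega⟩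
    have e8 := runs_step_halted s₁ P hle p w o
    rw [← hB6] at e8
    have e7 : Runs (ifFlag (clear .cl) step) B6.store _ _ := Runs.pop_nil (by simp [B6, B4, B2, recSt]) e8
    have e9 : Runs (push UR.wr true) (stepSt s₁ P pc p w 0).store
        (recSt s P Y K pc p w 0 (tr.drop (Y + K)) ([false] ++ un o ++ true :: cu) rest [true]).store 1 := by
      refine Runs.push' ?_
      simp [s₁, stepSt, recSt, un, List.drop_drop, Nat.add_comm Y K]
    have e3 : Runs recWork B2.store _ _ := e4.seq (e5.seq (e6.seq e7))
    have e2 : Runs (ifFlag recSkip recWork) B2.store _ _ := Runs.pop_nil (by simp [B2, recSt]) e3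
    refine Runs.of_eq (Runs.pop_cons' (f := recBody) (a := true) (w := blk o ++ rest) (by simp [recSt])
      (by simp [recSt]) (e1.seq (e2.seq e9))) rfl ?_
    unfold recCost stepCost; omega

/-- **A record in working mode, payment short**: `flag` is raised, the transcript exhausted, the
cursor and the work stack untouched. [folklore] -/
theorem runs_rec_payfail (s : USt) (hw : s.w = []) (P : UFlat.UProg) (Y K pc p : ℕ) (w : List Bool)
    (tr cu rest : List Bool) (o : ℕ) (htr : tr.length < Y + K) :
    ∃ fl' : ℕ, 1 ≤ fl' ∧
      Runs (pop .cur2 recBody) (recSt s P Y K pc p w 0 tr cu (true :: (blk o ++ rest)) []).store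
        (recSt s P Y K pc p w fl' [] ([false] ++ un o ++ true :: cu) rest [true]).store
        (11 * tr.length + 9 * o + 52) := by
  -- the stores met: `B f t` has `f` flag tokens and transcript `t`, claim read
  let B2 : USt := recSt s P Y K pc p w 0 tr (true :: cu) (blk o ++ rest) []
  let B : ℕ → List Bool → USt := fun f t =>
    { B2 with cur2 := rest, cur := [false] ++ un o ++ true :: cu, cl := un o, flag := un f, tr := t }
  have hBw : ∀ f t, (B f t).w = [] := fun _ _ => by simpa [B, B2, recSt] using hw
  have e1 : Runs (push UR.cur true) (recSt s P Y K pc p w 0 tr cu (blk o ++ rest) []).store B2.store 1 :=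
    Runs.push' (by simp [B2, recSt])
  have e4 : Runs (moveBlock .cur2 .cur .cl .w) B2.store (B 0 tr).store (7 * o + 7) := by
    have h := runs_moveBlock_cur2 B2 (a := o) (t := false :: rest) (Or.inr ⟨rest, rfl⟩)
      (by simp [B2, recSt, blk]) (by simpa [B2, recSt] using hw)
    exact h.of_eq (by simp [B2, B, recSt]) le_rfl
  -- after the payments: skip the step, clearing the claim
  have e7 : ∀ f : ℕ, Runs (ifFlag (clear .cl) step) (B (f + 1) []).store { (B (f + 1) []) with cl := [] }.store
      ((1 + (2 * o + 1)) + 2) := by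
    intro f
    refine Runs.pop_cons' (f := ifFlagBr (clear .cl) step) (a := true) (w := un f)
      (R₀ := { (B (f + 1) []) with flag := un f }.store)
      (by simp [B, un, List.replicate_succ]) (by simp [B]) ?_
    refine Runs.seq (Runs.push' (R' := (B (f + 1) []).store) (by simp [B, un, List.replicate_succ])) ?_
    exact runs_clear_of (B (f + 1) []) (by simp [B]) (by simp [B, B2, recSt])
  -- the two payments leave `f + 1` flag tokens and an empty transcript, for some `f`
  have e567 : ∃ f : ℕ, Runs (pay .yard .yard2 ;; pay .ky .ky2 ;; ifFlag (clear .cl) step) (B 0 tr).store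
      { (B (f + 1) []) with cl := [] }.store (11 * tr.length + 28 + ((1 + (2 * o + 1)) + 2)) := by
    by_cases hY : tr.length < Y
    · have e5 : Runs (pay .yard .yard2) (B 0 tr).store (B 1 []).store (11 * tr.length + 14) :=
        (runs_pay_yard_short (B 0 tr) (m := tr.length) (n := Y) (by simp [B, B2, recSt])
          (by simp [B, B2, recSt]) (by simp [B]) hY (hBw _ _)).of_eq (by simp [B]) le_rfl
      rcases Nat.eq_zero_or_pos K with hK | hK
      · have e6 : Runs (pay .ky .ky2) (B 1 []).store (B 1 []).store (11 * 0 + 7) :=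
          (runs_pay_ky_ok (B 1 []) (n := 0) (by simp [B, B2, recSt, hK]) (by simp [B, B2, recSt])
            (by simp [B]) (hBw _ _)).of_eq (by simp [B]) le_rfl
        exact ⟨0, (e5.seq (e6.seq (e7 0))).mono (by omega)⟩
      · have e6 : Runs (pay .ky .ky2) (B 1 []).store (B 2 []).store (11 * 0 + 14) :=
          (runs_pay_ky_short (B 1 []) (m := 0) (n := K) (by simp [B, B2, recSt]) (by simp [B, B2, recSt])
            (by simp [B]) hK (hBw _ _)).of_eq (by simp [B, un, List.replicate_succ]) le_rfl
        exact ⟨1, (e5.seq (e6.seq (e7 1))).mono (by omega)⟩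
    · have hY' : Y ≤ tr.length := Nat.le_of_not_lt hY
      have e5 : Runs (pay .yard .yard2) (B 0 tr).store (B 0 (tr.drop Y)).store (11 * Y + 7) :=
        (runs_pay_yard_ok (B 0 tr) (n := Y) (by simp [B, B2, recSt]) (by simp [B, B2, recSt])
          (by simp [B]; omega) (hBw _ _)).of_eq (by simp [B]) le_rfl
      have e6 : Runs (pay .ky .ky2) (B 0 (tr.drop Y)).store (B 1 []).store (11 * (tr.length - Y) + 14) :=
        (runs_pay_ky_short (B 0 (tr.drop Y)) (m := tr.length - Y) (n := K) (by simp [B, B2, recSt])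
          (by simp [B, B2, recSt]) (by simp [B]) (by omega) (hBw _ _)).of_eq (by simp [B]) le_rfl
      exact ⟨0, (e5.seq (e6.seq (e7 0))).mono (by omega)⟩
  obtain ⟨f, e567⟩ := e567
  refine ⟨f + 1, by omega, ?_⟩
  have e9 : Runs (push UR.wr true) { (B (f + 1) []) with cl := [] }.store
      (recSt s P Y K pc p w (f + 1) [] ([false] ++ un o ++ true :: cu) rest [true]).store 1 :=
    Runs.push' (by simp [B, B2, recSt])
  have e3 : Runs recWork B2.store _ _ := e4.seq e567
  have e2 : Runs (ifFlag recSkip recWork) B2.store _ _ := Runs.pop_nil (by simp [B2, recSt]) e3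
  refine Runs.of_eq (Runs.pop_cons' (f := recBody) (a := true) (w := blk o ++ rest) (by simp [recSt])
    (by simp [recSt]) (e1.seq (e2.seq e9))) rfl ?_
  omega

/-! ### The record loop -/

/-- `encClaims (o :: os)`. [folklore] -/
theorem encClaims_cons (o : ℕ) (os : List ℕ) : encClaims (o :: os) = true :: (blk o ++ encClaims os) := by
  simp [encClaims, encBody]

/-- The consumed copy grows by the reversed record. [folklore] -/
theorem reverse_encClaims_cons (o : ℕ) (os : List ℕ) (cu : List Bool) :
    (encClaims (o :: os)).reverse ++ cu = (encClaims os).reverse ++ ([false] ++ un o ++ true :: cu) := by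
  simp [encClaims, encBody, blk, un]

/-- Length of the claim copy. [folklore] -/
theorem length_encClaims (os : List ℕ) : (encClaims os).length = os.sum + 2 * os.length + 1 := by
  induction os with
  | nil => simp [encClaims, encBody]
  | cons o os ih =>
    rw [encClaims_cons]
    simp only [List.length_cons, List.length_append, blk, un, List.length_replicate, List.sum_cons,
      List.length_nil] at ih ⊢
    omega

/-- A cost bound for the record loop in skipping mode. [folklore] -/
def skipLoopCost (os : List ℕ) : ℕ := 9 * os.sum + 17 * os.length + 6

/-- **The record loop in skipping mode** parses the remaining claims and stops at the terminator.
[folklore] -/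
theorem runs_recLoop_skip (s : USt) (hw : s.w = []) (P : UFlat.UProg) (Y K pc p : ℕ) (w : List Bool)
    (fl : ℕ) (tr : List Bool) : ∀ (os : List ℕ) (cu : List Bool),
    Runs (loop .wr fun _ => pop .cur2 recBody)
      (recSt s P Y K pc p w (fl + 1) tr cu (encClaims os) [true]).store
      (recSt s P Y K pc p w (fl + 1) tr ((encClaims os).reverse ++ cu) [] []).store (skipLoopCost os)
  | [], cu => by
    have e := runs_rec_end s P Y K pc p w (fl + 1) tr cu []
    have h := Runs.loop_cons (k := UR.wr) (f := fun _ => pop .cur2 recBody)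
      (R := (recSt s P Y K pc p w (fl + 1) tr cu (encClaims []) [true]).store) (a := true) (w := [])
      (by simp [recSt]) (by simpa [recSt, encClaims, encBody] using e)
      (Runs.loop_nil _ (by simp))
    exact h.of_eq (by simp [recSt, encClaims, encBody]) (by simp [skipLoopCost])
  | o :: os, cu => by
    have e := runs_rec_skip s hw P Y K pc p w fl tr cu (encClaims os) o
    have ih := runs_recLoop_skip s hw P Y K pc p w fl tr os ([false] ++ un o ++ true :: cu)
    have h := Runs.loop_cons (k := UR.wr) (f := fun _ => pop .cur2 recBody)
      (R := (recSt s P Y K pc p w (fl + 1) tr cu (encClaims (o :: os)) [true]).store) (a := true) (w := [])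
      (by simp [recSt]) (by simpa [recSt, encClaims_cons] using e) ih
    refine h.of_eq (by rw [reverse_encClaims_cons]) ?_
    simp [skipLoopCost]; omega

/-- A cost bound for the record loop in working mode. [folklore] -/
def workLoopCost (P : UFlat.UProg) (Y K : ℕ) (os : List ℕ) : ℕ :=
  11 * os.sum + os.length * (11 * Y + 11 * K + 70 * (encProg P).length + 151) + 6

/-- `recCost` in terms of the summands of `workLoopCost`. [folklore] -/
theorem recCost_eq (P : UFlat.UProg) (Y K o : ℕ) :
    recCost P Y K o = 11 * o + (11 * Y + 11 * K + 70 * (encProg P).length + 149) := by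
  unfold recCost stepCost; omega

/-- **The record loop in working mode**: from cursor `pc`, work stack `w`, `flag` clear, the loop
processes all claims `os` and stops at the terminator; `flag` stays clear iff every record was
paid (`(Y + K) |os| ≤ |tr|`) and no claim was refuted (`UFlat.upassRun … ≠ none`), and then the
final cursor and work stack are those of `UFlat.upassRun`. [cite: AroraBarak2009, Thm. 3.2 (proof)] -/
theorem runs_recLoop_work (s : USt) (hw : s.w = []) (P : UFlat.UProg) (Y K p : ℕ)
    (hY : (encProg P).length ≤ Y) : ∀ (os : List ℕ) (pc : ℕ) (w : List Bool) (tr cu : List Bool),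
    ∃ (pc' : ℕ) (w' : List Bool) (fl' : ℕ) (tr' : List Bool),
      Runs (loop .wr fun _ => pop .cur2 recBody)
        (recSt s P Y K pc p w 0 tr cu (encClaims os) [true]).store
        (recSt s P Y K pc' p w' fl' tr' ((encClaims os).reverse ++ cu) [] []).store
        (81 * (tr.length - tr'.length) + 77 * (encClaims os).length + 6) ∧
      (fl' = 0 ↔ ((Y + K) * os.length ≤ tr.length ∧ UFlat.upassRun P p (pc, w) os ≠ none)) ∧
      (fl' = 0 → UFlat.upassRun P p (pc, w) os = some (pc', w') ∧ tr' = tr.drop ((Y + K) * os.length)) ∧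
      w'.length ≤ w.length + os.length ∧ (∃ d, tr' = tr.drop d)
  | [], pc, w, tr, cu => by
    refine ⟨pc, w, 0, tr, ?_, by simp [UFlat.upassRun], by simp [UFlat.upassRun], by simp, ⟨0, by simp⟩⟩
    have e := runs_rec_end s P Y K pc p w 0 tr cu []
    have h := Runs.loop_cons (k := UR.wr) (f := fun _ => pop .cur2 recBody)
      (R := (recSt s P Y K pc p w 0 tr cu (encClaims []) [true]).store) (a := true) (w := [])
      (by simp [recSt]) (by simpa [recSt, encClaims, encBody] using e)
      (Runs.loop_nil _ (by simp))
    exact h.of_eq (by simp [recSt, encClaims, encBody]) (by simp)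
  | o :: os, pc, w, tr, cu => by
    have hlen : (encClaims (o :: os)).length = (encClaims os).length + o + 2 := by
      rw [encClaims_cons]; simp [blk, un]; omega
    by_cases htr : Y + K ≤ tr.length
    · obtain ⟨pc₁, w₁, fl₁, e, hcase, hw₁⟩ := runs_rec_work s hw P Y K pc p w tr cu (encClaims os) o htr
      rcases hcase with ⟨hsome, rfl⟩ | ⟨hnone, rfl⟩
      · -- the claim passed: continue in working mode
        obtain ⟨pc', w', fl', tr', ih, h1, h2, h3, ⟨d, hd⟩⟩ :=
          runs_recLoop_work s hw P Y K p hY os pc₁ w₁ (tr.drop (Y + K)) ([false] ++ un o ++ true :: cu)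
        refine ⟨pc', w', fl', tr', ?_, ?_, ?_, ?_, ⟨Y + K + d, by rw [hd, List.drop_drop]⟩⟩
        · have h := Runs.loop_cons (k := UR.wr) (f := fun _ => pop .cur2 recBody)
            (R := (recSt s P Y K pc p w 0 tr cu (encClaims (o :: os)) [true]).store) (a := true) (w := [])
            (by simp [recSt]) (by simpa [recSt, encClaims_cons] using e) ih
          refine h.of_eq (by rw [reverse_encClaims_cons]) ?_
          have hd' : tr'.length + (Y + K) ≤ tr.length := by
            rw [hd, List.length_drop, List.length_drop]; omega
          rw [recCost_eq, hlen, List.length_drop]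
          omega
        · rw [h1, UFlat.upassRun, hsome, Option.bind_some, List.length_drop, List.length_cons]
          have hl := length_le_of_upass hsome
          constructor
          · rintro ⟨h, h'⟩; exact ⟨by rw [Nat.mul_succ]; omega, h'⟩
          · rintro ⟨h, h'⟩; exact ⟨by rw [Nat.mul_succ] at h; omega, h'⟩
        · intro hfl
          obtain ⟨h, h'⟩ := h2 hfl
          refine ⟨by rw [UFlat.upassRun, hsome, Option.bind_some, h], ?_⟩
          rw [h', List.drop_drop, List.length_cons, Nat.mul_succ, Nat.add_comm]
        · have hl := length_le_of_upass hsome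
          simp only [List.length_cons] at hl ⊢
          simpa using h3.trans (by omega)
      · -- the claim was refuted: skip the rest
        have ih := runs_recLoop_skip s hw P Y K pc₁ p w₁ 0 (tr.drop (Y + K)) os ([false] ++ un o ++ true :: cu)
        refine ⟨pc₁, w₁, 1, tr.drop (Y + K), ?_, ?_, fun h => absurd h one_ne_zero, ?_, ⟨Y + K, rfl⟩⟩
        · have h := Runs.loop_cons (k := UR.wr) (f := fun _ => pop .cur2 recBody)
            (R := (recSt s P Y K pc p w 0 tr cu (encClaims (o :: os)) [true]).store) (a := true) (w := [])
            (by simp [recSt]) (by simpa [recSt, encClaims_cons] using e) ih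
          refine h.of_eq (by rw [reverse_encClaims_cons]) ?_
          have hC := length_encClaims os
          rw [recCost_eq, hlen, List.length_drop, skipLoopCost]
          omega
        · simp [UFlat.upassRun, hnone]
        · simp only [List.length_cons]; omega
    · -- payment short
      have hlt : tr.length < Y + K := Nat.lt_of_not_le htr
      obtain ⟨fl₁, hfl₁, e⟩ := runs_rec_payfail s hw P Y K pc p w tr cu (encClaims os) o hlt
      obtain ⟨f, rfl⟩ : ∃ f, fl₁ = f + 1 := ⟨fl₁ - 1, by omega⟩
      have ih := runs_recLoop_skip s hw P Y K pc p w f [] os ([false] ++ un o ++ true :: cu)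
      refine ⟨pc, w, f + 1, [], ?_, ?_, fun h => absurd h (Nat.succ_ne_zero f), by simp,
        ⟨tr.length, by simp⟩⟩
      · have h := Runs.loop_cons (k := UR.wr) (f := fun _ => pop .cur2 recBody)
          (R := (recSt s P Y K pc p w 0 tr cu (encClaims (o :: os)) [true]).store) (a := true) (w := [])
          (by simp [recSt]) (by simpa [recSt, encClaims_cons] using e) ih
        refine h.of_eq (by rw [reverse_encClaims_cons]) ?_
        have hC := length_encClaims os
        rw [hlen, List.length_nil, skipLoopCost]
        omega
      · simp only [Nat.succ_ne_zero, false_iff, not_and, List.length_cons]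
        intro h; exfalso; rw [Nat.mul_succ] at h; omega

/-! ### A pass: initialisation, record loop, finish -/

/-- The store between the routines of a pass: program rewound, pass `p`, work stack `w`, `fl` flag
tokens, transcript rest `tr`, consumed copy `cu`, remaining copy `cu2`; the pass parameters
`Y = |code|`, `C` (copy length), `K` (passes), `inp`, `out`, `ini` on their registers; cursor
`pc`. [folklore] -/
def passSt (s : USt) (P : UFlat.UProg) (Y C K inp out : ℕ) (ini : List Bool) (pc p : ℕ)
    (w : List Bool) (fl : ℕ) (tr cu cu2 : List Bool) : USt :=
  { s with
      code := codeAt P pc, codeL := codeLAt P pc, yard := un Y, yard2 := [], ycopy := un C, ycopy2 := []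
      ky := un K, ky2 := [], tr := tr, cur := cu, cur2 := cu2, wk := w, pp := un p, pp2 := []
      inp := un inp, outr := un out, ini := ini, t1 := [], t2 := [], ac := [], kk := [], j0 := [], j1 := []
      j2 := [], cl := [], ne := [], flag := un fl, w := [], wr := [] }

/-- The pass store is a record-loop store. [folklore] -/
theorem passSt_eq_recSt (s : USt) (P : UFlat.UProg) (Y C K inp out : ℕ) (ini : List Bool) (pc p : ℕ)
    (w : List Bool) (fl : ℕ) (tr cu cu2 : List Bool) :
    passSt s P Y C K inp out ini pc p w fl tr cu cu2 =
      recSt { s with ycopy := un C, ycopy2 := [], inp := un inp, outr := un out, ini := ini, t2 := [], w := [] }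
        P Y K pc p w fl tr cu cu2 [] := by
  simp [passSt, recSt]

/-- **`initWk`**: the work stack receives the initial content of register `p` (`ini` if `p = inp`,
nothing otherwise), everything else is restored. [folklore] -/
theorem runs_initWk (s : USt) (P : UFlat.UProg) (Y C K inp out : ℕ) (ini : List Bool) (p : ℕ) (fl : ℕ)
    (tr cu cu2 : List Bool) :
    Runs initWk (passSt s P Y C K inp out ini 0 p [] fl tr cu cu2).store
      (passSt s P Y C K inp out ini 0 p (UFlat.initStore inp ini p) fl tr cu cu2).store
      (17 * inp + 22 + (if p = inp then 10 * ini.length else 0)) := by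
  -- copy `inp`
  have e1 : Runs (copy2 UR.inp .t1 .t2) (passSt s P Y C K inp out ini 0 p [] fl tr cu cu2).store
      { (passSt s P Y C K inp out ini 0 p [] fl tr cu cu2) with inp := [], t1 := un inp, t2 := un inp }.store
      (4 * inp + 1) :=
    (runs_copy2 (Γ := Bool) (a := UR.inp) (b := UR.t1) (c := UR.t2) (by decide) (by decide) (by decide) _).of_eq
      (by simp [passSt, un]) (by simp [passSt])
  have e2 : Runs (pour UR.t2 UR.inp)
      { (passSt s P Y C K inp out ini 0 p [] fl tr cu cu2) with inp := [], t1 := un inp, t2 := un inp }.store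
      { (passSt s P Y C K inp out ini 0 p [] fl tr cu cu2) with t1 := un inp }.store (3 * inp + 1) :=
    runs_pour_of (by decide) _ (by simp [passSt, un]) (by simp)
  have e3 : Runs (cmpUnary .t1 .pp .pp2 .ne ;; pour .pp2 .pp)
      { (passSt s P Y C K inp out ini 0 p [] fl tr cu cu2) with t1 := un inp }.store
      { (passSt s P Y C K inp out ini 0 p [] fl tr cu cu2) with ne := un (mis inp p) }.store (8 * inp + 6) :=
    (runs_cmpPP_t1 _ (x := inp) (p := p) rfl (by simp [passSt]) (by simp [passSt])).of_eq
      (by simp [passSt, mis]) le_rfl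
  have e4 : Runs (pop .ne iniBr)
      { (passSt s P Y C K inp out ini 0 p [] fl tr cu cu2) with ne := un (mis inp p) }.store
      (passSt s P Y C K inp out ini 0 p (UFlat.initStore inp ini p) fl tr cu cu2).store
      (2 * inp + 5 + (if p = inp then 10 * ini.length else 0)) := by
    by_cases hp : p = inp
    · subst hp
      rw [if_pos rfl]
      have h0 : mis p p = 0 := (mis_eq_zero_iff p p).2 rfl
      have f1 : Runs (copy2 UR.ini .t1 .t2) (passSt s P Y C K p out ini 0 p [] fl tr cu cu2).store
          { (passSt s P Y C K p out ini 0 p [] fl tr cu cu2) with ini := [], t1 := ini.reverse, t2 := ini.reverse }.store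
          (4 * ini.length + 1) :=
        (runs_copy2 (Γ := Bool) (a := UR.ini) (b := UR.t1) (c := UR.t2) (by decide) (by decide) (by decide) _).of_eq
          (by simp [passSt]) (by simp [passSt])
      have f2 : Runs (pour UR.t1 UR.wk)
          { (passSt s P Y C K p out ini 0 p [] fl tr cu cu2) with ini := [], t1 := ini.reverse, t2 := ini.reverse }.store
          { (passSt s P Y C K p out ini 0 p [] fl tr cu cu2) with ini := [], t2 := ini.reverse, wk := ini }.store
          (3 * ini.length + 1) :=
        runs_pour_of (by decide) _ (by simp [passSt]) (by simp)
      have f3 : Runs (pour UR.t2 UR.ini)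
          { (passSt s P Y C K p out ini 0 p [] fl tr cu cu2) with ini := [], t2 := ini.reverse, wk := ini }.store
          (passSt s P Y C K p out ini 0 p (UFlat.initStore p ini p) fl tr cu cu2).store (3 * ini.length + 1) :=
        runs_pour_of (by decide) _ (by simp [passSt, UFlat.initStore]) (by simp)
      refine (Runs.pop_nil (by simp [passSt, h0]) ((f1.seq (f2.seq f3)).start ?_)).mono (by omega)
      simp [passSt, h0]
    · rw [if_neg hp]
      obtain ⟨d, hd⟩ : ∃ d, mis inp p = d + 1 :=
        ⟨mis inp p - 1, by have := (mis_eq_zero_iff inp p).not.2 (Ne.symm hp); omega⟩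
      have hdle := mis_le inp p
      have f : Runs (iniBr (some true))
          { (passSt s P Y C K inp out ini 0 p [] fl tr cu cu2) with ne := un d }.store
          (passSt s P Y C K inp out ini 0 p (UFlat.initStore inp ini p) fl tr cu cu2).store (2 * d + 1) :=
        runs_clear_of _ (by simp [passSt, UFlat.initStore, update_of_ne hp]) (by simp)
      refine Runs.mono (Runs.pop_cons' (f := iniBr) (a := true) (w := un d)
        (by simp [hd, un, List.replicate_succ]) (by simp) f) ?_
      omega
  unfold initWk copyUn
  refine Runs.mono ((e1.seq e2).seq (e3.seq e4)) ?_
  omega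

/-- The verdict of `checkWk`: one more flag token unless the work stack is exactly `[1]`.
[folklore] -/
def wkBad (w : List Bool) : ℕ := if w = [true] then 0 else 1

/-- **`checkWk`**. [folklore] -/
theorem runs_checkWk (s : USt) (w : List Bool) (fl : ℕ) :
    ∃ w' : List Bool, w'.length ≤ w.length ∧ Runs checkWk { s with wk := w, flag := un fl }.store
      { s with wk := w', flag := un (fl + wkBad w) }.store 5 := by
  let T : List Bool → ℕ → USt := fun w f => { s with wk := w, flag := un f }
  have PUSH : ∀ w f, Runs (push UR.flag true) (T w f).store (T w (f + 1)).store 1 := fun w f =>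
    Runs.push' (by simp [T, un, List.replicate_succ])
  show ∃ w' : List Bool, w'.length ≤ w.length ∧ Runs checkWk (T w fl).store (T w' (fl + wkBad w)).store 5
  unfold checkWk wkBad
  rcases w with _ | ⟨_ | _, _ | ⟨b, w⟩⟩
  · refine ⟨[], le_rfl, ?_⟩
    have e : Runs (wkBr1 none) (T [] fl).store (T [] (fl + 1)).store 1 := PUSH [] fl
    exact Runs.of_eq (Runs.pop_nil (by simp [T]) e) (by simp) (by omega)
  · refine ⟨[], by simp, ?_⟩
    have e : Runs (wkBr1 (some false)) (T [] fl).store (T [] (fl + 1)).store 1 := PUSH [] fl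
    exact Runs.of_eq (Runs.pop_cons' (f := wkBr1) (a := false) (w := []) (by simp [T]) (by simp [T]) e)
      (by simp) (by omega)
  · refine ⟨b :: w, by simp, ?_⟩
    have e : Runs (wkBr1 (some false)) (T (b :: w) fl).store (T (b :: w) (fl + 1)).store 1 := PUSH _ fl
    exact Runs.of_eq (Runs.pop_cons' (f := wkBr1) (a := false) (w := b :: w) (by simp [T]) (by simp [T]) e)
      (by simp) (by omega)
  · refine ⟨[], by simp, ?_⟩
    have e2 : Runs (wkBr2 none) (T [] fl).store (T [] fl).store 0 := Runs.skip _
    have e : Runs (wkBr1 (some true)) (T [] fl).store (T [] fl).store 2 := Runs.pop_nil (by simp [T]) e2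
    exact Runs.of_eq (Runs.pop_cons' (f := wkBr1) (a := true) (w := []) (by simp [T]) (by simp [T]) e)
      (by simp) (by omega)
  · refine ⟨w, by simp; omega, ?_⟩
    have e2 : Runs (wkBr2 (some b)) (T w fl).store (T w (fl + 1)).store 1 := PUSH w fl
    have e : Runs (wkBr1 (some true)) (T (b :: w) fl).store (T w (fl + 1)).store 3 :=
      Runs.pop_cons' (f := wkBr2) (a := b) (w := w) (by simp [T]) (by simp [T]) e2
    exact Runs.of_eq (Runs.pop_cons' (f := wkBr1) (a := true) (w := b :: w) (by simp [T]) (by simp [T]) e)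
      (by simp) (by omega)

/-- The verdict of the halting check: one more flag token unless the cursor is halted. [folklore] -/
def haltBad (P : UFlat.UProg) (pc : ℕ) : ℕ := if P.length ≤ pc then 0 else 1

/-- **`finish`**: the halting check, the output check in pass `out`, and the clean-up which rewinds
the program and restores the claim copy for the next pass. [folklore] -/
theorem runs_finish (s : USt) (P : UFlat.UProg) (Y C K inp out : ℕ) (ini : List Bool) (pc p : ℕ)
    (w : List Bool) (fl : ℕ) (tr cu : List Bool) :
    Runs finish (passSt s P Y C K inp out ini pc p w fl tr cu []).store
      (passSt s P Y C K inp out ini 0 p [] (fl + haltBad P pc + (if p = out then wkBad w else 0)) tr []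
        cu.reverse).store
      (17 * out + 2 * w.length + 3 * (encProg P).length + 3 * cu.length + 32) := by
  -- the stores met: `A f wk` after the halting check (`f` flag tokens, work stack `wk`)
  let A : ℕ → List Bool → USt := fun f wk => passSt s P Y C K inp out ini pc p wk f tr cu []
  -- halting check
  have e1 : Runs (pop .code haltBr) (A fl w).store (A (fl + haltBad P pc) w).store 4 := by
    unfold haltBad
    by_cases hpc : P.length ≤ pc
    · rw [if_pos hpc]
      exact (Runs.pop_nil (by simp [A, passSt, codeAt_eq_nil_of_le hpc]) (Runs.skip _)).mono (by omega)
    · rw [if_neg hpc]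
      have hlt : pc < P.length := Nat.lt_of_not_le hpc
      obtain ⟨b, rest, hb⟩ : ∃ b rest, codeAt P pc = b :: rest := by
        rw [codeAt_eq_of_lt hlt]
        cases h : encInstr P[pc] ++ codeAt P (pc + 1) with
        | nil => have := congrArg List.length h; simp at this
        | cons b rest => exact ⟨b, rest, rfl⟩
      have g2 : Runs (push UR.flag true) (A fl w).store (A (fl + 1) w).store 1 :=
        Runs.push' (by simp [A, passSt, un, List.replicate_succ])
      have g1 : Runs (push UR.code b) (update (A fl w).store .code rest) (A fl w).store 1 :=
        Runs.push' (by simp [A, passSt, hb])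
      exact Runs.pop_cons' (f := haltBr) (a := b) (w := rest) (by simp [A, passSt, hb]) rfl (g1.seq g2)
  -- from here on `f` flag tokens
  have REST : ∀ f : ℕ, Runs (copyUn .outr ;; (cmpUnary .t1 .pp .pp2 .ne ;; pour .pp2 .pp) ;; pop .ne outBr ;;
      clear .wk ;; pour .codeL .code ;; clear .cur2 ;; pour .cur .cur2) (A f w).store
      (passSt s P Y C K inp out ini 0 p [] (f + (if p = out then wkBad w else 0)) tr [] cu.reverse).store
      (17 * out + 2 * w.length + 3 * (encProg P).length + 3 * cu.length + 28) := by
    intro f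
    have c1 : Runs (copy2 UR.outr .t1 .t2) (A f w).store
        { (A f w) with outr := [], t1 := un out, t2 := un out }.store (4 * out + 1) :=
      (runs_copy2 (Γ := Bool) (a := UR.outr) (b := UR.t1) (c := UR.t2) (by decide) (by decide) (by decide)
        _).of_eq (by simp [A, passSt, un]) (by simp [A, passSt])
    have c2 : Runs (pour UR.t2 UR.outr) { (A f w) with outr := [], t1 := un out, t2 := un out }.store
        { (A f w) with t1 := un out }.store (3 * out + 1) :=
      runs_pour_of (by decide) _ (by simp [A, passSt, un]) (by simp)
    have c3 : Runs (cmpUnary .t1 .pp .pp2 .ne ;; pour .pp2 .pp) { (A f w) with t1 := un out }.store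
        { (A f w) with ne := un (mis out p) }.store (8 * out + 6) :=
      (runs_cmpPP_t1 _ (x := out) (p := p) rfl (by simp [A, passSt]) (by simp [A, passSt])).of_eq
        (by simp [A, passSt, mis]) le_rfl
    -- the output check
    have c4 : ∃ w' : List Bool, w'.length ≤ w.length ∧
        Runs (pop .ne outBr) { (A f w) with ne := un (mis out p) }.store
          (A (f + (if p = out then wkBad w else 0)) w').store (2 * out + 10) := by
      by_cases hp : p = out
      · subst hp
        have h0 : mis p p = 0 := (mis_eq_zero_iff p p).2 rfl
        obtain ⟨w', hle, hw'⟩ := runs_checkWk (A f w) w f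
        have g : Runs (outBr none) { (A f w) with ne := un (mis p p) }.store (A (f + wkBad w) w').store 5 :=
          (hw'.start (by simp [A, passSt, h0])).of_eq (by simp [A, passSt]) le_rfl
        refine ⟨w', hle, Runs.of_eq (Runs.pop_nil (by simp [A, passSt, h0]) g) (by simp) (by omega)⟩
      · obtain ⟨d, hd⟩ : ∃ d, mis out p = d + 1 :=
          ⟨mis out p - 1, by have := (mis_eq_zero_iff out p).not.2 (Ne.symm hp); omega⟩
        have hdle := mis_le out p
        have g : Runs (outBr (some true)) { (A f w) with ne := un d }.store (A f w).store (2 * d + 1) :=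
          runs_clear_of { (A f w) with ne := un d } (by simp [A, passSt]) (by simp)
        refine ⟨w, le_rfl, Runs.of_eq (Runs.pop_cons' (f := outBr) (a := true) (w := un d)
          (by simp [hd, un, List.replicate_succ]) (by simp) g) (by simp [hp]) (by omega)⟩
    obtain ⟨w', hw', c4⟩ := c4
    set f' := f + (if p = out then wkBad w else 0) with hf'
    -- clean-up
    have c5 : Runs (clear .wk) (A f' w').store (A f' []).store (2 * w'.length + 1) :=
      runs_clear_of _ (by simp [A, passSt]) (by simp [A, passSt])
    have c6 : Runs (pour .codeL .code) (A f' []).store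
        (passSt s P Y C K inp out ini 0 p [] f' tr cu []).store (3 * (codeLAt P pc).length + 1) :=
      runs_pour_of (by decide) _ (by simp [A, passSt, reverse_codeLAt_append_codeAt]) (by simp [A, passSt])
    have c7 : Runs (clear .cur2) (passSt s P Y C K inp out ini 0 p [] f' tr cu []).store
        (passSt s P Y C K inp out ini 0 p [] f' tr cu []).store (2 * 0 + 1) :=
      runs_clear_of _ (by simp [passSt]) (by simp [passSt])
    have c8 : Runs (pour .cur .cur2) (passSt s P Y C K inp out ini 0 p [] f' tr cu []).store
        (passSt s P Y C K inp out ini 0 p [] f' tr [] cu.reverse).store (3 * cu.length + 1) :=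
      runs_pour_of (by decide) _ (by simp [passSt]) (by simp [passSt])
    have hcl := length_codeLAt_add P pc
    unfold copyUn
    refine Runs.mono ((c1.seq c2).seq (c3.seq (c4.seq (c5.seq (c6.seq (c7.seq c8)))))) ?_
    omega
  unfold finish
  refine Runs.mono (e1.seq (REST _)) ?_
  omega

/-! ### A pass -/

/-- The payment of one pass on the claims `os`: the copy, the code, the pass count, and per
record the code and the pass count again. [folklore] -/
def payTotal (Y C K : ℕ) (os : List ℕ) : ℕ := C + Y + K + (Y + K) * os.length

/-- What pass `p` checks: the claims pass, end halted, and in pass `out` leave `[1]` on the work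
stack (the conjunct of `UFlat.UAccepts` for `p`). [folklore] -/
def PassOK (P : UFlat.UProg) (inp out : ℕ) (ini : List Bool) (os : List ℕ) (p : ℕ) : Prop :=
  ∃ q w', UFlat.upassRun P p (0, UFlat.initStore inp ini p) os = some (q, w') ∧ P.length ≤ q ∧
    (p = out → w' = [true])

/-- A cost bound for one pass. [folklore] -/
def passCost (P : UFlat.UProg) (Y C K inp out : ℕ) (ini : List Bool) (os : List ℕ) : ℕ :=
  11 * (C + Y + K) + 17 * inp + 17 * out + 12 * ini.length + 2 * os.length + 3 * (encProg P).length +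
    3 * (encClaims os).length + workLoopCost P Y K os + 140

/-- The three payments of a pass, from `f` flag tokens: either all fit (`flag` unchanged, the
transcript advanced), or `flag` is raised. [folklore] -/
theorem runs_pays (s : USt) (P : UFlat.UProg) (Y C K inp out : ℕ) (ini : List Bool) (p : ℕ)
    (tr cu2 : List Bool) :
    ∃ (f : ℕ) (tr' : List Bool),
      Runs (pay .ycopy .ycopy2 ;; pay .yard .yard2 ;; pay .ky .ky2)
        (passSt s P Y C K inp out ini 0 p [] 0 tr [] cu2).store
        (passSt s P Y C K inp out ini 0 p [] f tr' [] cu2).store (11 * (tr.length - tr'.length) + 42) ∧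
      (C + Y + K ≤ tr.length → f = 0 ∧ tr' = tr.drop (C + Y + K)) ∧
      (tr.length < C + Y + K → 1 ≤ f) ∧ (∃ d, tr' = tr.drop d) := by
  -- one payment on a pass store with yardstick of length `n`: a uniform statement
  let X : ℕ → List Bool → USt := fun f t => passSt s P Y C K inp out ini 0 p [] f t [] cu2
  have ONE : ∀ (pr : Prog) (n : ℕ),
      (∀ f t, n ≤ t.length → Runs pr (X f t).store (X f (t.drop n)).store (11 * n + 7)) →
      (∀ f t, t.length < n → Runs pr (X f t).store (X (f + 1) []).store (11 * t.length + 14)) →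
      ∀ f t, ∃ f' t', Runs pr (X f t).store (X f' t').store (11 * (t.length - t'.length) + 14) ∧
        (n ≤ t.length → f' = f ∧ t' = t.drop n) ∧ (t.length < n → f' = f + 1 ∧ t' = []) ∧ f ≤ f' ∧
        t'.length ≤ t.length ∧ (∃ d, t' = t.drop d) := by
    intro pr n hok hsh f t
    by_cases h : n ≤ t.length
    · exact ⟨f, t.drop n, (hok f t h).mono (by simp; omega), fun _ => ⟨rfl, rfl⟩,
        fun h' => absurd h' (by omega), le_rfl, by simp, ⟨n, rfl⟩⟩
    · have h' : t.length < n := Nat.lt_of_not_le h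
      exact ⟨f + 1, [], (hsh f t h').mono (by simp), fun h'' => absurd h'' h, fun _ => ⟨rfl, rfl⟩,
        by omega, by simp, ⟨t.length, by simp⟩⟩
  have P1 := ONE (pay .ycopy .ycopy2) C
    (fun f t h => (runs_pay_ycopy_ok (X f t) (n := C) (by simp [X, passSt]) (by simp [X, passSt])
      (by simpa [X, passSt] using h) (by simp [X, passSt])).of_eq (by simp [X, passSt]) le_rfl)
    (fun f t h => (runs_pay_ycopy_short (X f t) (m := t.length) (n := C) (by simp [X, passSt])
      (by simp [X, passSt]) (by simp [X, passSt]) h (by simp [X, passSt])).of_eq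
      (by simp [X, passSt, un, List.replicate_succ]) le_rfl)
  have P2 := ONE (pay .yard .yard2) Y
    (fun f t h => (runs_pay_yard_ok (X f t) (n := Y) (by simp [X, passSt]) (by simp [X, passSt])
      (by simpa [X, passSt] using h) (by simp [X, passSt])).of_eq (by simp [X, passSt]) le_rfl)
    (fun f t h => (runs_pay_yard_short (X f t) (m := t.length) (n := Y) (by simp [X, passSt])
      (by simp [X, passSt]) (by simp [X, passSt]) h (by simp [X, passSt])).of_eq
      (by simp [X, passSt, un, List.replicate_succ]) le_rfl)
  have P3 := ONE (pay .ky .ky2) K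
    (fun f t h => (runs_pay_ky_ok (X f t) (n := K) (by simp [X, passSt]) (by simp [X, passSt])
      (by simpa [X, passSt] using h) (by simp [X, passSt])).of_eq (by simp [X, passSt]) le_rfl)
    (fun f t h => (runs_pay_ky_short (X f t) (m := t.length) (n := K) (by simp [X, passSt])
      (by simp [X, passSt]) (by simp [X, passSt]) h (by simp [X, passSt])).of_eq
      (by simp [X, passSt, un, List.replicate_succ]) le_rfl)
  obtain ⟨f1, t1, r1, ok1, sh1, le1, ln1, d1, hd1⟩ := P1 0 tr
  obtain ⟨f2, t2, r2, ok2, sh2, le2, ln2, d2, hd2⟩ := P2 f1 t1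
  obtain ⟨f3, t3, r3, ok3, sh3, le3, ln3, d3, hd3⟩ := P3 f2 t2
  have hcost : 11 * (tr.length - t1.length) + 14 + (11 * (t1.length - t2.length) + 14 +
      (11 * (t2.length - t3.length) + 14)) ≤ 11 * (tr.length - t3.length) + 42 := by omega
  refine ⟨f3, t3, (r1.seq (r2.seq r3)).mono hcost, fun h => ?_, fun h => ?_,
    ⟨d1 + d2 + d3, by rw [hd3, hd2, hd1, List.drop_drop, List.drop_drop]; congr 1; omega⟩⟩
  · obtain ⟨rfl, rfl⟩ := ok1 (by omega)
    obtain ⟨rfl, rfl⟩ := ok2 (by simp; omega)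
    obtain ⟨rfl, rfl⟩ := ok3 (by simp; omega)
    exact ⟨rfl, by rw [List.drop_drop, List.drop_drop]; congr 1; omega⟩
  · -- some payment runs short
    by_cases h1 : tr.length < C
    · have := (sh1 h1).1; omega
    · obtain ⟨rfl, rfl⟩ := ok1 (by omega)
      by_cases h2 : (tr.drop C).length < Y
      · have := (sh2 h2).1; omega
      · obtain ⟨rfl, rfl⟩ := ok2 (by omega)
        have h3 : ((tr.drop C).drop Y).length < K := by
          simp only [List.length_drop] at h2 ⊢; omega
        have := (sh3 h3).1; omega

/-- **One pass**: the payments; unless they fail, the work stack is initialised, the claims are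
run through pass `p`, and the finish checks halting (and the output in pass `out`); afterwards
the store is ready for the next pass. `flag` stays clear iff the payments fit and `PassOK`.
[cite: AroraBarak2009, Thm. 3.2 (proof)] -/
theorem runs_pass (s : USt) (P : UFlat.UProg) (K inp out : ℕ) (hinp : inp ≤ K) (hout : out ≤ K)
    (ini : List Bool) (p : ℕ) (os : List ℕ) (tr : List Bool) :
    ∃ (fl' : ℕ) (tr' : List Bool),
      Runs pass (passSt s P (encProg P).length (encClaims os).length K inp out ini 0 p [] 0 tr [] (encClaims os)).store
        (passSt s P (encProg P).length (encClaims os).length K inp out ini 0 p [] fl' tr' [] (encClaims os)).store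
        (130 * (tr.length - tr'.length) + (if p = inp then 12 * ini.length else 0) + 110) ∧
      (fl' = 0 ↔ (payTotal (encProg P).length (encClaims os).length K os ≤ tr.length ∧ PassOK P inp out ini os p)) ∧
      (fl' = 0 → tr' = tr.drop (payTotal (encProg P).length (encClaims os).length K os)) ∧ (∃ d, tr' = tr.drop d) := by
  set Y := (encProg P).length with hY
  let s' : USt :=
    { s with ycopy := un (encClaims os).length, ycopy2 := [], inp := un inp, outr := un out, ini := ini, t2 := [], w := [] }
  have hs'w : s'.w = [] := rfl
  let PS : ℕ → List Bool → ℕ → List Bool → List Bool → List Bool → USt := fun pc w fl t cu cu2 =>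
    passSt s P Y (encClaims os).length K inp out ini pc p w fl t cu cu2
  obtain ⟨f, tr₁, epay, hok, hsh, ⟨d₁, hd₁⟩⟩ := runs_pays s P Y (encClaims os).length K inp out ini p tr (encClaims os)
  unfold pass
  by_cases hfit : (encClaims os).length + Y + K ≤ tr.length
  · obtain ⟨rfl, rfl⟩ := hok hfit
    set t₀ := tr.drop ((encClaims os).length + Y + K) with ht₀
    set w₀ := UFlat.initStore inp ini p with hw₀
    -- the body: initialise, loop, finish
    have e1 : Runs initWk (PS 0 [] 0 t₀ [] (encClaims os)).store (PS 0 w₀ 0 t₀ [] (encClaims os)).store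
        (17 * inp + 22 + (if p = inp then 10 * ini.length else 0)) :=
      runs_initWk s P Y (encClaims os).length K inp out ini p 0 t₀ [] (encClaims os)
    have e2 : Runs (push UR.wr true) (PS 0 w₀ 0 t₀ [] (encClaims os)).store
        (recSt s' P Y K 0 p w₀ 0 t₀ [] (encClaims os) [true]).store 1 :=
      Runs.push' (by simp [PS, passSt, recSt, s'])
    obtain ⟨pc', w', fl', tr', e3, h1, h2, h3, ⟨d, hd⟩⟩ := runs_recLoop_work s' hs'w P Y K p (le_of_eq hY.symm) os 0 w₀ t₀ []
    have e4 := runs_finish s P Y (encClaims os).length K inp out ini pc' p w' fl' tr' (encClaims os).reverse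
    rw [List.reverse_reverse] at e4
    have e4' : Runs finish (recSt s' P Y K pc' p w' fl' tr' ((encClaims os).reverse ++ []) [] []).store _ _ :=
      e4.start (by simp [passSt, recSt, s'])
    have ebody : Runs (initWk ;; recLoop ;; finish) (PS 0 [] 0 t₀ [] (encClaims os)).store _ _ :=
      e1.seq ((e2.seq e3).seq e4')
    have eif : Runs (ifFlag skip (initWk ;; recLoop ;; finish)) (PS 0 [] 0 t₀ [] (encClaims os)).store _ _ :=
      Runs.pop_nil (by simp [PS, passSt]) ebody
    have hw₀l : w₀.length ≤ (if p = inp then ini.length else 0) := by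
      rw [hw₀, UFlat.initStore]
      by_cases h : p = inp
      · subst h; simp
      · rw [update_of_ne h, if_neg h]; simp
    have ht₀l : t₀.length = tr.length - ((encClaims os).length + Y + K) := by rw [ht₀, List.length_drop]
    have htr'l : tr'.length ≤ t₀.length := by rw [hd, List.length_drop]; omega
    have hC : os.length ≤ (encClaims os).length := by rw [length_encClaims]; omega
    refine ⟨fl' + haltBad P pc' + (if p = out then wkBad w' else 0), tr', Runs.mono (epay.seq eif) ?_, ?_, ?_,
      ⟨(encClaims os).length + Y + K + d, by rw [hd, ht₀, List.drop_drop, Nat.add_comm]⟩⟩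
    · -- the cost
      have hcons : tr.length - tr'.length = ((encClaims os).length + Y + K) + (t₀.length - tr'.length) := by omega
      simp only [List.length_reverse]
      rw [hcons]
      by_cases hp : p = inp
      · simp only [if_pos hp] at hw₀l ⊢; omega
      · simp only [if_neg hp] at hw₀l ⊢; omega
    · -- the verdict
      constructor
      · intro h0
        have hfl : fl' = 0 := by omega
        have hhb : haltBad P pc' = 0 := by omega
        have hwb : (if p = out then wkBad w' else 0) = 0 := by omega
        obtain ⟨hpay, hrun⟩ := h2 hfl
        refine ⟨?_, pc', w', by rw [hw₀] at hpay; exact hpay, ?_, fun hp => ?_⟩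
        · have := (h1.1 hfl).1; simp only [payTotal]; omega
        · unfold haltBad at hhb; split_ifs at hhb with h; exact h
        · subst hp; simp only [if_true, wkBad] at hwb; split_ifs at hwb with h; exact h
      · rintro ⟨hpay, q, w'', hrun, hq, hw''⟩
        rw [← hw₀] at hrun
        have hfl : fl' = 0 := by
          refine h1.2 ⟨?_, by rw [hrun]; simp⟩
          simp only [payTotal] at hpay; omega
        obtain ⟨hrun', -⟩ := h2 hfl
        rw [hrun] at hrun'
        have epair := Option.some.inj hrun'
        rw [Prod.mk.injEq] at epair
        obtain ⟨hq1, hw1⟩ := epair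
        rw [hq1] at hq
        rw [hw1] at hw''
        have hhb : haltBad P pc' = 0 := by unfold haltBad; rw [if_pos hq]
        have hwb : (if p = out then wkBad w' else 0) = 0 := by
          split_ifs with hp
          · rw [wkBad, if_pos (hw'' hp)]
          · rfl
        omega
    · intro h0
      have hfl : fl' = 0 := by omega
      rw [(h2 hfl).2, ht₀, List.drop_drop, payTotal]
  · -- the payments failed
    have hf : 1 ≤ f := hsh (Nat.lt_of_not_le hfit)
    obtain ⟨f', rfl⟩ : ∃ f', f = f' + 1 := ⟨f - 1, by omega⟩
    have epush : Runs (push UR.flag true) { (PS 0 [] (f' + 1) tr₁ [] (encClaims os)) with flag := un f' }.store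
        (PS 0 [] (f' + 1) tr₁ [] (encClaims os)).store 1 :=
      Runs.push' (by simp [PS, passSt, un, List.replicate_succ])
    have eif : Runs (ifFlag skip (initWk ;; recLoop ;; finish)) (PS 0 [] (f' + 1) tr₁ [] (encClaims os)).store
        (PS 0 [] (f' + 1) tr₁ [] (encClaims os)).store ((1 + 0) + 2) :=
      Runs.pop_cons' (f := ifFlagBr skip (initWk ;; recLoop ;; finish)) (a := true) (w := un f')
        (by simp [PS, passSt, un, List.replicate_succ]) (by simp [PS, passSt]) (epush.seq (Runs.skip _))
    refine ⟨f' + 1, tr₁, Runs.mono (epay.seq eif) ?_, ?_, fun h => absurd h (Nat.succ_ne_zero _), ⟨d₁, hd₁⟩⟩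
    · omega
    · simp only [Nat.succ_ne_zero, false_iff, not_and, payTotal]
      intro h; exfalso; omega

/-! ### The pass loop -/

/-- Whether the passes from `p` on may still meet the input pass `inp` (and copy `ini`). [folklore] -/
def hit (p inp : ℕ) : ℕ := if inp < p then 0 else 1

/-- **The pass loop** runs `m` passes `p, p+1, …, p+m-1` (one per token of `np`), counting them on
`pp`; once `flag` is raised the remaining passes are skipped in two steps each. `flag` stays
clear iff it was clear, all payments fit, and every pass is `PassOK`.
[cite: AroraBarak2009, Thm. 3.2 (proof)] -/
theorem runs_passes (s : USt) (P : UFlat.UProg) (K inp out : ℕ) (hinp : inp ≤ K) (hout : out ≤ K)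
    (ini : List Bool) (os : List ℕ) :
    ∀ (m p fl : ℕ) (tr : List Bool), ∃ (fl' : ℕ) (tr' : List Bool),
      Runs passes
        (passSt { s with np := un m } P (encProg P).length (encClaims os).length K inp out ini 0 p [] fl tr [] (encClaims os)).store
        (passSt { s with np := [] } P (encProg P).length (encClaims os).length K inp out ini 0 (p + m) [] fl' tr' []
          (encClaims os)).store
        (130 * (tr.length - tr'.length) + 12 * ini.length * hit p inp + 116 * m + 1) ∧
      (fl' = 0 ↔ (fl = 0 ∧ m * payTotal (encProg P).length (encClaims os).length K os ≤ tr.length ∧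
        ∀ i < m, PassOK P inp out ini os (p + i))) ∧
      (fl' = 0 → tr' = tr.drop (m * payTotal (encProg P).length (encClaims os).length K os)) ∧ (∃ d, tr' = tr.drop d)
  | 0, p, fl, tr => by
    refine ⟨fl, tr, ?_, by simp, by simp, ⟨0, by simp⟩⟩
    exact (Runs.loop_nil _ (by simp [passSt])).of_eq (by simp [passSt]) (by omega)
  | m + 1, p, fl, tr => by
    let X : ℕ → ℕ → ℕ → List Bool → USt := fun n q f t =>
      passSt { s with np := un n } P (encProg P).length (encClaims os).length K inp out ini 0 q [] f t [] (encClaims os)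
    -- one iteration of the body: a pass or a skip, then count the pass
    have body : ∃ (fl₁ : ℕ) (tr₁ : List Bool),
        Runs (ifFlag skip pass ;; push .pp true) (X m p fl tr).store (X m (p + 1) fl₁ tr₁).store
          (130 * (tr.length - tr₁.length) + (if p = inp then 12 * ini.length else 0) + 114) ∧
        (fl₁ = 0 ↔ (fl = 0 ∧ payTotal (encProg P).length (encClaims os).length K os ≤ tr.length ∧ PassOK P inp out ini os p)) ∧
        (fl₁ = 0 → tr₁ = tr.drop (payTotal (encProg P).length (encClaims os).length K os)) ∧ (∃ d, tr₁ = tr.drop d) := by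
      have COUNT : ∀ f t, Runs (push UR.pp true) (X m p f t).store (X m (p + 1) f t).store 1 := fun f t =>
        Runs.push' (by simp [X, passSt, un, List.replicate_succ])
      rcases fl with _ | f
      · obtain ⟨fl₁, tr₁, e, h1, h2, h3⟩ := runs_pass { s with np := un m } P K inp out hinp hout ini p os tr
        have e' : Runs (ifFlag skip pass) (X m p 0 tr).store (X m p fl₁ tr₁).store _ :=
          Runs.pop_nil (by simp [X, passSt]) e
        exact ⟨fl₁, tr₁, Runs.mono (e'.seq (COUNT _ _)) (by omega), by simpa using h1, h2, h3⟩
      · have epush : Runs (push UR.flag true) { (X m p (f + 1) tr) with flag := un f }.store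
            (X m p (f + 1) tr).store 1 := Runs.push' (by simp [X, passSt, un, List.replicate_succ])
        have e' : Runs (ifFlag skip pass) (X m p (f + 1) tr).store (X m p (f + 1) tr).store ((1 + 0) + 2) :=
          Runs.pop_cons' (f := ifFlagBr skip pass) (a := true) (w := un f)
            (by simp [X, passSt, un, List.replicate_succ]) (by simp [X, passSt]) (epush.seq (Runs.skip _))
        exact ⟨f + 1, tr, Runs.mono (e'.seq (COUNT _ _)) (by omega), by simp,
          fun h => absurd h (Nat.succ_ne_zero _), ⟨0, by simp⟩⟩
    obtain ⟨fl₁, tr₁, ebody, hb1, hb2, ⟨db, hdb⟩⟩ := body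
    obtain ⟨fl', tr', erest, hr1, hr2, ⟨dr, hdr⟩⟩ :=
      runs_passes s P K inp out hinp hout ini os m (p + 1) fl₁ tr₁
    refine ⟨fl', tr', ?_, ?_, ?_, ⟨db + dr, by rw [hdr, hdb, List.drop_drop]⟩⟩
    · have h := Runs.loop_cons (k := UR.np) (f := fun _ => ifFlag skip pass ;; push .pp true)
        (R := (X (m + 1) p fl tr).store) (a := true) (w := un m)
        (by simp [X, passSt, un, List.replicate_succ]) (ebody.start (by simp [X, passSt])) erest
      refine h.of_eq (by rw [Nat.add_assoc, Nat.add_comm 1 m]) ?_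
      have hl1 : tr₁.length ≤ tr.length := by rw [hdb, List.length_drop]; omega
      have hl2 : tr'.length ≤ tr₁.length := by rw [hdr, List.length_drop]; omega
      have hhit : (if p = inp then 12 * ini.length else 0) + 12 * ini.length * hit (p + 1) inp ≤
          12 * ini.length * hit p inp := by
        unfold hit
        by_cases hp : p = inp
        · subst hp; simp
        · rw [if_neg hp]
          by_cases h1 : inp < p
          · rw [if_pos h1, if_pos (by omega)]; omega
          · rw [if_neg h1, if_neg (by omega)]; omega
      omega
    · rw [hr1, hb1]
      constructor
      · rintro ⟨⟨hfl, hpt, hok⟩, hm, hall⟩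
        refine ⟨hfl, ?_, fun i hi => ?_⟩
        · rw [hb2 (hb1.2 ⟨hfl, hpt, hok⟩), List.length_drop] at hm
          rw [Nat.succ_mul]; omega
        · rcases i with _ | i
          · simpa using hok
          · have := hall i (by omega); rwa [show p + (i + 1) = p + 1 + i by omega]
      · rintro ⟨hfl, hm, hall⟩
        have hok : PassOK P inp out ini os p := by simpa using hall 0 (by omega)
        have hpt : payTotal (encProg P).length (encClaims os).length K os ≤ tr.length := by rw [Nat.succ_mul] at hm; omega
        refine ⟨⟨hfl, hpt, hok⟩, ?_, fun i hi => ?_⟩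
        · rw [hb2 (hb1.2 ⟨hfl, hpt, hok⟩), List.length_drop]
          rw [Nat.succ_mul] at hm; omega
        · have := hall (i + 1) (by omega); rwa [show p + 1 + i = p + (i + 1) by omega]
    · intro h0
      have h1 : fl₁ = 0 := (hr1.1 h0).1
      rw [hr2 h0, hb2 h1, List.drop_drop, Nat.succ_mul, Nat.add_comm]

/-! ### Building the yardstick; the dry parse of the claim copy -/

/-- **`buildYard`**: `yard := 1^{|code|}`, the code restored. [folklore] -/
theorem runs_buildYard (s : USt) (c : List Bool) :
    Runs buildYard { s with code := c, codeL := [], yard := [] }.store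
      { s with code := c, codeL := [], yard := un c.length }.store ((2 + 2) * c.length + 1 + (3 * c.length + 1)) := by
  unfold buildYard
  have h1 := runs_loop_inv (k := UR.code) (f := fun b => push .codeL b ;; push .yard true)
    (fun done rest => ({ s with code := rest, codeL := done, yard := un done.length } : USt).store)
    (fun _ _ => True) 2 (fun _ _ _ => by simp)
    (fun done a rest _ => ⟨trivial, by
      refine Runs.seq (R₁ := ({ s with code := rest, codeL := a :: done, yard := un done.length } : USt).store)
        (Runs.push' (by simp)) (Runs.push' (by simp [un, List.replicate_succ]))⟩)
    c [] trivial
  simp only [List.append_nil, List.length_reverse] at h1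
  have h2 : Runs (pour .codeL .code) ({ s with code := [], codeL := c.reverse, yard := un c.length } : USt).store
      { s with code := c, codeL := [], yard := un c.length }.store (3 * c.length + 1) :=
    runs_pour_of (by decide) _ (by simp) (by simp)
  exact h1.seq h2

/-- The store of the dry parse: transcript `t`, consumed copy `cu` (reversed), `yc` symbols counted,
`fl` flag tokens, loop token `wr`. [folklore] -/
def drySt (s : USt) (t cu : List Bool) (yc fl : ℕ) (wr : List Bool) : USt :=
  { s with tr := t, cur := cu, ycopy := un yc, flag := un fl, wr := wr, w := [] }

/-- A claim record in the dry parse. [folklore] -/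
theorem runs_dry_rec (s : USt) (o : ℕ) (t cu : List Bool) (yc fl : ℕ) :
    Runs (pop .tr dryBody) (drySt s (true :: (blk o ++ t)) cu yc fl []).store
      (drySt s t ([false] ++ un o ++ true :: cu) (yc + o + 2) fl [true]).store (7 * o + 13) := by
  let D : List Bool → List Bool → ℕ → List Bool → USt := fun t cu yc wr => drySt s t cu yc fl wr
  have p1 : Runs (push UR.cur true) (D (blk o ++ t) cu yc []).store (D (blk o ++ t) (true :: cu) yc []).store 1 :=
    Runs.push' (by simp [D, drySt])
  have p2 : Runs (push UR.ycopy true) (D (blk o ++ t) (true :: cu) yc []).store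
      (D (blk o ++ t) (true :: cu) (yc + 1) []).store 1 := Runs.push' (by simp [D, drySt, un, List.replicate_succ])
  have p3 : Runs (push UR.ycopy true) (D (blk o ++ t) (true :: cu) (yc + 1) []).store
      (D (blk o ++ t) (true :: cu) (yc + 2) []).store 1 := Runs.push' (by simp [D, drySt, un, List.replicate_succ])
  have e2 : Runs (moveBlock .tr .cur .ycopy .w) (D (blk o ++ t) (true :: cu) (yc + 2) []).store
      (D t ([false] ++ un o ++ true :: cu) (yc + o + 2) []).store (7 * o + 7) := by
    have h := runs_moveBlock_tr (D (blk o ++ t) (true :: cu) (yc + 2) []) (a := o) (t := false :: t)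
      (Or.inr ⟨t, rfl⟩) (by simp [D, drySt, blk]) (by simp [D, drySt])
    refine h.of_eq ?_ le_rfl
    have e : o + (yc + 2) = yc + o + 2 := by omega
    simp [D, drySt, un, e]
  have e3 : Runs (push UR.wr true) (D t ([false] ++ un o ++ true :: cu) (yc + o + 2) []).store
      (D t ([false] ++ un o ++ true :: cu) (yc + o + 2) [true]).store 1 := Runs.push' (by simp [D, drySt])
  have e : Runs (dryBody (some true)) (D (blk o ++ t) cu yc []).store _ _ := p1.seq (p2.seq (p3.seq (e2.seq e3)))
  exact Runs.of_eq (Runs.pop_cons' (f := dryBody) (a := true) (w := blk o ++ t) (by simp [drySt]) (by simp [D, drySt]) e)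
    rfl (by omega)

/-- The terminator record in the dry parse. [folklore] -/
theorem runs_dry_end (s : USt) (t cu : List Bool) (yc fl : ℕ) :
    Runs (pop .tr dryBody) (drySt s (false :: t) cu yc fl []).store (drySt s t (false :: cu) (yc + 1) fl []).store 4 := by
  have p1 : Runs (push UR.cur false) (drySt s t cu yc fl []).store (drySt s t (false :: cu) yc fl []).store 1 :=
    Runs.push' (by simp [drySt])
  have p2 : Runs (push UR.ycopy true) (drySt s t (false :: cu) yc fl []).store
      (drySt s t (false :: cu) (yc + 1) fl []).store 1 := Runs.push' (by simp [drySt, un, List.replicate_succ])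
  exact Runs.pop_cons' (f := dryBody) (a := false) (w := t) (by simp [drySt]) (by simp [drySt]) (p1.seq p2)

/-- An exhausted transcript in the dry parse raises `flag`. [folklore] -/
theorem runs_dry_none (s : USt) (cu : List Bool) (yc fl : ℕ) :
    Runs (pop .tr dryBody) (drySt s [] cu yc fl []).store (drySt s [] cu yc (fl + 1) []).store 3 :=
  Runs.pop_nil (by simp [drySt]) (Runs.push' (by simp [drySt, un, List.replicate_succ]))

/-- An unterminated claim block at the end of the transcript is swallowed whole. [folklore] -/
theorem runs_dry_open (s : USt) (a : ℕ) (cu : List Bool) (yc fl : ℕ) :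
    Runs (pop .tr dryBody) (drySt s (true :: un a) cu yc fl []).store
      (drySt s [] (un a ++ true :: cu) (yc + a + 2) fl [true]).store (7 * a + 13) := by
  let D : List Bool → List Bool → ℕ → List Bool → USt := fun t cu yc wr => drySt s t cu yc fl wr
  have p1 : Runs (push UR.cur true) (D (un a) cu yc []).store (D (un a) (true :: cu) yc []).store 1 :=
    Runs.push' (by simp [D, drySt])
  have p2 : Runs (push UR.ycopy true) (D (un a) (true :: cu) yc []).store (D (un a) (true :: cu) (yc + 1) []).store 1 :=
    Runs.push' (by simp [D, drySt, un, List.replicate_succ])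
  have p3 : Runs (push UR.ycopy true) (D (un a) (true :: cu) (yc + 1) []).store
      (D (un a) (true :: cu) (yc + 2) []).store 1 := Runs.push' (by simp [D, drySt, un, List.replicate_succ])
  have e2 : Runs (moveBlock .tr .cur .ycopy .w) (D (un a) (true :: cu) (yc + 2) []).store
      (D [] (un a ++ true :: cu) (yc + a + 2) []).store (7 * a + 7) := by
    have h := runs_moveBlock_tr (D (un a) (true :: cu) (yc + 2) []) (a := a) (t := [])
      (Or.inl rfl) (by simp [D, drySt]) (by simp [D, drySt])
    refine h.of_eq ?_ le_rfl
    have e : a + (yc + 2) = yc + a + 2 := by omega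
    simp [D, drySt, un, e]
  have e3 : Runs (push UR.wr true) (D [] (un a ++ true :: cu) (yc + a + 2) []).store
      (D [] (un a ++ true :: cu) (yc + a + 2) [true]).store 1 := Runs.push' (by simp [D, drySt])
  have e : Runs (dryBody (some true)) (D (un a) cu yc []).store _ _ := p1.seq (p2.seq (p3.seq (e2.seq e3)))
  exact Runs.of_eq (Runs.pop_cons' (f := dryBody) (a := true) (w := un a) (by simp [drySt]) (by simp [D, drySt]) e)
    rfl (by omega)

/-- **The dry parse of a well-formed copy**: the claims are consumed from `tr`, kept reversed on
`cur`, and counted symbol for symbol on `ycopy`. [folklore] -/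
theorem runs_dryLoop_ok (s : USt) (fl : ℕ) : ∀ (os : List ℕ) (rest cu : List Bool) (yc : ℕ),
    Runs (loop .wr fun _ => pop .tr dryBody) (drySt s (encClaims os ++ rest) cu yc fl [true]).store
      (drySt s rest ((encClaims os).reverse ++ cu) (yc + (encClaims os).length) fl []).store
      (8 * (encClaims os).length + 7)
  | [], rest, cu, yc => by
    have e := runs_dry_end s rest cu yc fl
    have h := Runs.loop_cons (k := UR.wr) (f := fun _ => pop .tr dryBody)
      (R := (drySt s (encClaims [] ++ rest) cu yc fl [true]).store) (a := true) (w := [])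
      (by simp [drySt]) (e.start (by simp [drySt, encClaims, encBody])) (Runs.loop_nil _ (by simp [drySt]))
    exact h.of_eq (by simp [drySt, encClaims, encBody]) (by simp [encClaims, encBody])
  | o :: os, rest, cu, yc => by
    have e := runs_dry_rec s o (encClaims os ++ rest) cu yc fl
    have ih := runs_dryLoop_ok s fl os rest ([false] ++ un o ++ true :: cu) (yc + o + 2)
    have h := Runs.loop_cons (k := UR.wr) (f := fun _ => pop .tr dryBody)
      (R := (drySt s (encClaims (o :: os) ++ rest) cu yc fl [true]).store) (a := true) (w := [])
      (by simp [drySt]) (e.start (by simp [drySt, encClaims_cons])) ih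
    have hlen : (encClaims (o :: os)).length = (encClaims os).length + o + 2 := by
      rw [encClaims_cons]; simp [blk, un]; omega
    refine h.of_eq ?_ ?_
    · rw [reverse_encClaims_cons, hlen]
      congr 2; omega
    · rw [hlen]; omega

/-- **The dry parse of a copy without terminator** raises `flag`. [folklore] -/
theorem runs_dryLoop_body (s : USt) (fl : ℕ) : ∀ (os : List ℕ) (cu : List Bool) (yc : ℕ),
    Runs (loop .wr fun _ => pop .tr dryBody) (drySt s (encBody os) cu yc fl [true]).store
      (drySt s [] ((encBody os).reverse ++ cu) (yc + (encBody os).length) (fl + 1) []).store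
      (8 * (encBody os).length + 6)
  | [], cu, yc => by
    have e := runs_dry_none s cu yc fl
    have h := Runs.loop_cons (k := UR.wr) (f := fun _ => pop .tr dryBody)
      (R := (drySt s (encBody []) cu yc fl [true]).store) (a := true) (w := [])
      (by simp [drySt]) (e.start (by simp [drySt, encBody])) (Runs.loop_nil _ (by simp [drySt]))
    exact h.of_eq (by simp [drySt, encBody]) (by simp [encBody])
  | o :: os, cu, yc => by
    have e := runs_dry_rec s o (encBody os) cu yc fl
    have ih := runs_dryLoop_body s fl os ([false] ++ un o ++ true :: cu) (yc + o + 2)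
    have h := Runs.loop_cons (k := UR.wr) (f := fun _ => pop .tr dryBody)
      (R := (drySt s (encBody (o :: os)) cu yc fl [true]).store) (a := true) (w := [])
      (by simp [drySt]) (e.start (by simp [drySt, encBody_cons])) ih
    have hlen : (encBody (o :: os)).length = (encBody os).length + o + 2 := by
      rw [encBody_cons]; simp [blk, un]; omega
    have ec : yc + o + 2 + (encBody os).length = yc + ((encBody os).length + o + 2) := by omega
    refine h.of_eq ?_ ?_
    · rw [hlen]; simp [encBody_cons, blk, un, ec]
    · rw [hlen]; omega

/-- **The dry parse of a copy ending in an unterminated block** raises `flag`. [folklore] -/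
theorem runs_dryLoop_open (s : USt) (fl : ℕ) : ∀ (os : List ℕ) (a : ℕ) (cu : List Bool) (yc : ℕ),
    Runs (loop .wr fun _ => pop .tr dryBody) (drySt s (encBody os ++ true :: un a) cu yc fl [true]).store
      (drySt s [] (un a ++ true :: ((encBody os).reverse ++ cu)) (yc + (encBody os).length + a + 2) (fl + 1) []).store
      (8 * (encBody os).length + 7 * a + 21)
  | [], a, cu, yc => by
    have e := runs_dry_open s a cu yc fl
    have e' := runs_dry_none s (un a ++ true :: cu) (yc + a + 2) fl
    have h' := Runs.loop_cons (k := UR.wr) (f := fun _ => pop .tr dryBody)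
      (R := (drySt s [] (un a ++ true :: cu) (yc + a + 2) fl [true]).store) (a := true) (w := [])
      (by simp [drySt]) (e'.start (by simp [drySt])) (Runs.loop_nil _ (by simp [drySt]))
    have h := Runs.loop_cons (k := UR.wr) (f := fun _ => pop .tr dryBody)
      (R := (drySt s (encBody [] ++ true :: un a) cu yc fl [true]).store) (a := true) (w := [])
      (by simp [drySt]) (e.start (by simp [drySt, encBody])) h'
    exact h.of_eq (by simp [drySt, encBody]) (by simp [encBody])
  | o :: os, a, cu, yc => by
    have e := runs_dry_rec s o (encBody os ++ true :: un a) cu yc fl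
    have ih := runs_dryLoop_open s fl os a ([false] ++ un o ++ true :: cu) (yc + o + 2)
    have h := Runs.loop_cons (k := UR.wr) (f := fun _ => pop .tr dryBody)
      (R := (drySt s (encBody (o :: os) ++ true :: un a) cu yc fl [true]).store) (a := true) (w := [])
      (by simp [drySt]) (e.start (by simp [drySt, encBody_cons])) ih
    have hlen : (encBody (o :: os)).length = (encBody os).length + o + 2 := by
      rw [encBody_cons]; simp [blk, un]; omega
    have ec : yc + o + 2 + (encBody os).length + a + 2 = yc + ((encBody os).length + o + 2) + a + 2 := by omega
    refine h.of_eq ?_ ?_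
    · rw [hlen]; simp [encBody_cons, blk, un, ec]
    · rw [hlen]; omega

/-- **Every word is a claim copy followed by a rest, or a truncated copy** (missing its
terminator, possibly inside a block). [folklore] -/
theorem claims_cases : ∀ (n : ℕ) (tr : List Bool), tr.length ≤ n →
    (∃ os rest, tr = encClaims os ++ rest) ∨ (∃ os, tr = encBody os) ∨
      (∃ os a, tr = encBody os ++ true :: un a)
  | n, [], _ => Or.inr (Or.inl ⟨[], by simp [encBody]⟩)
  | n, false :: rest, _ => Or.inl ⟨[], rest, by simp [encClaims, encBody]⟩
  | 0, true :: rest, h => by simp at h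
  | n + 1, true :: rest, h => by
    obtain ⟨a, t, ht, rfl⟩ := exists_un_append_isTail rest
    rcases ht with rfl | ⟨t', rfl⟩
    · exact Or.inr (Or.inr ⟨[], a, by simp [encBody]⟩)
    · have hlen : t'.length ≤ n := by simp at h; omega
      rcases claims_cases n t' hlen with ⟨os, r, h'⟩ | ⟨os, h'⟩ | ⟨os, b, h'⟩
      · exact Or.inl ⟨a :: os, r, by rw [h', encClaims_cons]; simp [blk]⟩
      · exact Or.inr (Or.inl ⟨a :: os, by rw [h', encBody_cons]; simp [blk]⟩)
      · exact Or.inr (Or.inr ⟨a :: os, b, by rw [h', encBody_cons]; simp [blk]⟩)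

/-- Blocks are uniquely decodable at the head of a word. [folklore] -/
theorem blk_append_inj {a b : ℕ} {x y : List Bool} (h : blk a ++ x = blk b ++ y) : a = b ∧ x = y := by
  induction a generalizing b with
  | zero =>
    cases b with
    | zero => simpa [blk, un] using h
    | succ b => simp [blk, un, List.replicate_succ] at h
  | succ a ih =>
    cases b with
    | zero => simp [blk, un, List.replicate_succ] at h
    | succ b =>
      simp only [blk, un, List.replicate_succ, List.cons_append, List.cons.injEq, true_and] at h
      have := ih (b := b) (by simpa [blk, un] using h)
      exact ⟨by rw [this.1], this.2⟩

/-- Claim copies are uniquely decodable at the head of a word. [folklore] -/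
theorem encClaims_append_inj : ∀ {os os' : List ℕ} {x y : List Bool},
    encClaims os ++ x = encClaims os' ++ y → os = os' ∧ x = y
  | [], [], x, y, h => by simpa [encClaims, encBody] using h
  | [], o' :: os', x, y, h => by simp [encClaims, encBody] at h
  | o :: os, [], x, y, h => by simp [encClaims, encBody] at h
  | o :: os, o' :: os', x, y, h => by
    rw [encClaims_cons, encClaims_cons, List.cons_append, List.cons_append, List.cons.injEq,
      List.append_assoc, List.append_assoc] at h
    obtain ⟨rfl, h'⟩ := blk_append_inj h.2
    obtain ⟨rfl, rfl⟩ := encClaims_append_inj h'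
    exact ⟨rfl, rfl⟩

/-- A truncated copy is not a copy followed by a rest. [folklore] -/
theorem encClaims_append_ne_encBody : ∀ {os os' : List ℕ} {y : List Bool},
    encClaims os' ++ y ≠ encBody os
  | [], [], y, h => by simp [encClaims, encBody] at h
  | [], o' :: os', y, h => by simp [encClaims, encBody] at h
  | o :: os, [], y, h => by simp [encClaims, encBody] at h
  | o :: os, o' :: os', y, h => by
    rw [encClaims_cons, encBody_cons, List.cons_append, List.cons.injEq, List.append_assoc] at h
    obtain ⟨rfl, h'⟩ := blk_append_inj h.2
    exact encClaims_append_ne_encBody h'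

/-- A copy truncated inside a block is not a copy followed by a rest. [folklore] -/
theorem encClaims_append_ne_open : ∀ {os os' : List ℕ} {a : ℕ} {y : List Bool},
    encClaims os' ++ y ≠ encBody os ++ true :: un a
  | [], [], a, y, h => by simp [encClaims, encBody] at h
  | [], o' :: os', a, y, h => by
    rw [encClaims_cons, encBody, List.flatMap_nil, List.nil_append, List.cons_append, List.cons.injEq] at h
    have h2 := congrArg (fun l => false ∈ l) h.2
    simp [blk, un] at h2
  | o :: os, [], a, y, h => by simp [encClaims, encBody] at h
  | o :: os, o' :: os', a, y, h => by
    rw [encClaims_cons, encBody_cons, List.cons_append, List.cons_append, List.cons.injEq, List.append_assoc,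
      List.append_assoc] at h
    obtain ⟨rfl, h'⟩ := blk_append_inj h.2
    exact encClaims_append_ne_open h'

/-! ### The checker: effect, cost and verdict -/

/-- The input store of the checker: the program, the yardstick `1^K` (`K ≥ inp, out`), the number
of passes `m`, the input/output register numbers, the initial content of the input register, the
transcript. [folklore] -/
def U0 (P : UFlat.UProg) (K m inp out : ℕ) (ini tr : List Bool) : USt :=
  { code := encProg P, ky := un K, np := un m, inp := un inp, outr := un out, ini := ini, tr := tr }

/-- The verdict of the checker: the transcript is a claim copy followed by enough payment for `m`
passes, and the claims are accepted by every pass `p < m` (`UFlat.UAccepts`). [folklore] -/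
def UGood (P : UFlat.UProg) (K m inp out : ℕ) (ini tr : List Bool) : Prop :=
  ∃ (os : List ℕ) (pay : List Bool), tr = encClaims os ++ pay ∧
    m * payTotal (encProg P).length (encClaims os).length K os ≤ pay.length ∧
    UFlat.UAccepts P m inp out ini os

/-- The cost constant of the checker. [folklore] -/
def Uconst : ℕ := 160

/-- **The transcript checker: effect, linear running time and verdict.** From the input store,
`U` ends with the transcript consumed, the pass counter emptied and `fl` flag tokens, everything
else as at the start, within `Uconst · (|code| + |tr| + |ini| + m) + Uconst` steps — linear in its
registers with a universal constant — and `fl = 0` iff the transcript is a correctly paid claim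
copy accepted by all `m` passes (`UGood`). [cite: AroraBarak2009, Thm. 3.2 (proof)] -/
theorem runs_U (P : UFlat.UProg) (K m inp out : ℕ) (hinp : inp ≤ K) (hout : out ≤ K) (ini tr : List Bool) :
    ∃ fl : ℕ, Runs U (U0 P K m inp out ini tr).store
      { (U0 P K m inp out ini tr) with tr := [], np := [], flag := un fl }.store
      (Uconst * ((encProg P).length + tr.length + ini.length + m) + Uconst) ∧
    (fl = 0 ↔ UGood P K m inp out ini tr) := by
  let S : USt := U0 P K m inp out ini tr
  -- the yardstick
  have e1 : Runs buildYard S.store { S with yard := un (encProg P).length }.store ((2 + 2) * (encProg P).length + 1 + (3 * (encProg P).length + 1)) :=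
    (runs_buildYard S (encProg P)).start (by simp [S, U0])
  -- the final clears
  have CLR : ∀ (pp np yd yc cu cu2 t : List Bool) (f : ℕ),
      Runs (clear .pp ;; clear .np ;; clear .yard ;; clear .ycopy ;; clear .cur ;; clear .cur2 ;; clear .tr)
        { S with pp := pp, np := np, yard := yd, ycopy := yc, cur := cu, cur2 := cu2, tr := t, flag := un f }.store
        { S with tr := [], np := [], flag := un f }.store
        ((2 * pp.length + 1) + ((2 * np.length + 1) + ((2 * yd.length + 1) + ((2 * yc.length + 1) +
          ((2 * cu.length + 1) + ((2 * cu2.length + 1) + (2 * t.length + 1))))))) := by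
    intro pp np yd yc cu cu2 t f
    let T : List Bool → List Bool → List Bool → List Bool → List Bool → List Bool → List Bool → USt :=
      fun pp np yd yc cu cu2 t =>
        { S with pp := pp, np := np, yard := yd, ycopy := yc, cur := cu, cur2 := cu2, tr := t, flag := un f }
    have c1 : Runs (clear .pp) (T pp np yd yc cu cu2 t).store (T [] np yd yc cu cu2 t).store (2 * pp.length + 1) :=
      runs_clear_of _ (by simp [T]) (by simp [T])
    have c2 : Runs (clear .np) (T [] np yd yc cu cu2 t).store (T [] [] yd yc cu cu2 t).store (2 * np.length + 1) :=
      runs_clear_of _ (by simp [T]) (by simp [T])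
    have c3 : Runs (clear .yard) (T [] [] yd yc cu cu2 t).store (T [] [] [] yc cu cu2 t).store (2 * yd.length + 1) :=
      runs_clear_of _ (by simp [T]) (by simp [T])
    have c4 : Runs (clear .ycopy) (T [] [] [] yc cu cu2 t).store (T [] [] [] [] cu cu2 t).store (2 * yc.length + 1) :=
      runs_clear_of _ (by simp [T]) (by simp [T])
    have c5 : Runs (clear .cur) (T [] [] [] [] cu cu2 t).store (T [] [] [] [] [] cu2 t).store (2 * cu.length + 1) :=
      runs_clear_of _ (by simp [T]) (by simp [T])
    have c6 : Runs (clear .cur2) (T [] [] [] [] [] cu2 t).store (T [] [] [] [] [] [] t).store (2 * cu2.length + 1) :=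
      runs_clear_of _ (by simp [T]) (by simp [T])
    have c7 : Runs (clear .tr) (T [] [] [] [] [] [] t).store (T [] [] [] [] [] [] []).store (2 * t.length + 1) :=
      runs_clear_of _ (by simp [T]) (by simp [T])
    exact (c1.seq (c2.seq (c3.seq (c4.seq (c5.seq (c6.seq c7)))))).of_eq (by simp [T, S, U0]) le_rfl
  unfold U
  rcases claims_cases tr.length tr le_rfl with ⟨os, pay, htr⟩ | ⟨os, htr⟩ | ⟨os, a, htr⟩
  · -- a well-formed claim copy: dry parse, then the passes
    have d1 : Runs (push UR.wr true) { S with yard := un (encProg P).length }.store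
        (drySt { S with yard := un (encProg P).length } tr [] 0 0 [true]).store 1 := Runs.push' (by simp [S, U0, drySt])
    have d2 := runs_dryLoop_ok { S with yard := un (encProg P).length } 0 os pay [] 0
    rw [← htr, List.append_nil, Nat.zero_add] at d2
    have d3 : Runs (pour .cur .cur2) (drySt { S with yard := un (encProg P).length } pay (encClaims os).reverse (encClaims os).length 0 []).store
        (passSt S P (encProg P).length (encClaims os).length K inp out ini 0 0 [] 0 pay [] (encClaims os)).store (3 * (encClaims os).length + 1) :=
      runs_pour_of (by decide) _ (by simp [S, U0, drySt, passSt, codeAt, codeLAt, encProg])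
        (by simp [drySt])
    have e2 : Runs dryParse { S with yard := un (encProg P).length }.store (passSt S P (encProg P).length (encClaims os).length K inp out ini 0 0 [] 0 pay [] (encClaims os)).store
        (1 + ((8 * (encClaims os).length + 7) + (3 * (encClaims os).length + 1))) := by
      unfold dryParse; exact d1.seq (d2.seq d3)
    obtain ⟨fl', tr', e3, h1, h2, ⟨d, hd⟩⟩ := runs_passes S P K inp out hinp hout ini os m 0 0 pay
    have e3' : Runs (ifFlag skip passes) (passSt S P (encProg P).length (encClaims os).length K inp out ini 0 0 [] 0 pay [] (encClaims os)).store
        (passSt { S with np := [] } P (encProg P).length (encClaims os).length K inp out ini 0 (0 + m) [] fl' tr' [] (encClaims os)).store _ :=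
      Runs.pop_nil (by simp [passSt]) (e3.start (by simp [S, U0, passSt]))
    have e4 := CLR (un m) [] (un (encProg P).length) (un (encClaims os).length) [] (encClaims os) tr' fl'
    have e4' : Runs (clear .pp ;; clear .np ;; clear .yard ;; clear .ycopy ;; clear .cur ;; clear .cur2 ;; clear .tr)
        (passSt { S with np := [] } P (encProg P).length (encClaims os).length K inp out ini 0 (0 + m) [] fl' tr' [] (encClaims os)).store
        { S with tr := [], np := [], flag := un fl' }.store _ :=
      e4.start (by simp [S, U0, passSt, codeAt, codeLAt, encProg])
    refine ⟨fl', Runs.mono (e1.seq (e2.seq (e3'.seq e4'))) ?_, ?_⟩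
    · have hCt : (encClaims os).length ≤ tr.length := by rw [htr]; simp
      have hpt : pay.length ≤ tr.length := by rw [htr]; simp
      have htr' : tr'.length ≤ pay.length := by rw [hd, List.length_drop]; omega
      simp only [un, List.length_replicate, List.length_nil, Uconst, hit]
      split_ifs <;> omega
    · rw [h1]
      constructor
      · rintro ⟨-, hpay, hall⟩
        refine ⟨os, pay, htr, hpay, fun p hp => ?_⟩
        simpa [PassOK] using hall p hp
      · rintro ⟨os', pay', htr', hpay, hacc⟩
        rw [htr] at htr'
        obtain ⟨rfl, rfl⟩ := encClaims_append_inj htr'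
        exact ⟨rfl, hpay, fun i hi => by simpa [PassOK] using hacc i hi⟩
  · -- a truncated copy: the dry parse raises the flag, everything else is skipped
    have d1 : Runs (push UR.wr true) { S with yard := un (encProg P).length }.store
        (drySt { S with yard := un (encProg P).length } tr [] 0 0 [true]).store 1 := Runs.push' (by simp [S, U0, drySt])
    have d2 := runs_dryLoop_body { S with yard := un (encProg P).length } 0 os [] 0
    rw [← htr, List.append_nil, Nat.zero_add, Nat.zero_add] at d2
    let B : USt := { S with yard := un (encProg P).length, tr := [], cur := [], cur2 := tr, ycopy := un tr.length, flag := un 1 }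
    have d3 : Runs (pour .cur .cur2) (drySt { S with yard := un (encProg P).length } [] tr.reverse tr.length 1 []).store B.store
        (3 * tr.length + 1) :=
      runs_pour_of (by decide) _ (by simp [S, U0, drySt, B]) (by simp [drySt])
    have e2 : Runs dryParse { S with yard := un (encProg P).length }.store B.store (1 + ((8 * tr.length + 6) + (3 * tr.length + 1))) := by
      unfold dryParse; exact d1.seq (d2.seq d3)
    have e3a : Runs (ifFlagBr skip passes (some true)) { B with flag := [] }.store B.store (1 + 0) :=
      (Runs.push' (by simp [B, un])).seq (Runs.skip _)
    have e3 : Runs (ifFlag skip passes) B.store B.store ((1 + 0) + 2) :=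
      Runs.pop_cons' (f := ifFlagBr skip passes) (a := true) (w := []) (by simp [B, un]) (by simp [B]) e3a
    have e4 : Runs (clear .pp ;; clear .np ;; clear .yard ;; clear .ycopy ;; clear .cur ;; clear .cur2 ;; clear .tr)
        B.store { S with tr := [], np := [], flag := un 1 }.store _ :=
      (CLR [] (un m) (un (encProg P).length) (un tr.length) [] tr [] 1).start (by simp [B, S, U0])
    refine ⟨1, Runs.mono (e1.seq (e2.seq (e3.seq e4))) ?_, ?_⟩
    · simp only [un, List.length_replicate, List.length_nil, Uconst]; omega
    · simp only [Nat.one_ne_zero, false_iff, UGood]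
      rintro ⟨os', pay', htr', -, -⟩
      exact encClaims_append_ne_encBody (htr'.symm.trans htr)
  · -- a copy truncated inside a block
    have d1 : Runs (push UR.wr true) { S with yard := un (encProg P).length }.store
        (drySt { S with yard := un (encProg P).length } tr [] 0 0 [true]).store 1 := Runs.push' (by simp [S, U0, drySt])
    have d2 := runs_dryLoop_open { S with yard := un (encProg P).length } 0 os a [] 0
    rw [← htr, List.append_nil, Nat.zero_add, Nat.zero_add] at d2
    have hlen : tr.length = (encBody os).length + a + 1 := by rw [htr]; simp [un]; omega
    let B : USt := { S with
        yard := un (encProg P).length, tr := [], cur := [], cur2 := (un a ++ true :: (encBody os).reverse).reverse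
        ycopy := un ((encBody os).length + a + 2), flag := un 1 }
    have d3 : Runs (pour .cur .cur2)
        (drySt { S with yard := un (encProg P).length } [] (un a ++ true :: (encBody os).reverse) ((encBody os).length + a + 2) 1 []).store
        B.store (3 * ((encBody os).length + a + 1) + 1) :=
      runs_pour_of (by decide) _ (by simp [S, U0, drySt, B]) (by simp [drySt, un]; omega)
    have e2 : Runs dryParse { S with yard := un (encProg P).length }.store B.store
        (1 + ((8 * (encBody os).length + 7 * a + 21) + (3 * ((encBody os).length + a + 1) + 1))) := by
      unfold dryParse; exact d1.seq (d2.seq d3)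
    have e3a : Runs (ifFlagBr skip passes (some true)) { B with flag := [] }.store B.store (1 + 0) :=
      (Runs.push' (by simp [B, un])).seq (Runs.skip _)
    have e3 : Runs (ifFlag skip passes) B.store B.store ((1 + 0) + 2) :=
      Runs.pop_cons' (f := ifFlagBr skip passes) (a := true) (w := []) (by simp [B, un]) (by simp [B]) e3a
    have e4 : Runs (clear .pp ;; clear .np ;; clear .yard ;; clear .ycopy ;; clear .cur ;; clear .cur2 ;; clear .tr)
        B.store { S with tr := [], np := [], flag := un 1 }.store _ :=
      (CLR [] (un m) (un (encProg P).length) (un ((encBody os).length + a + 2)) []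
        (un a ++ true :: (encBody os).reverse).reverse [] 1).start (by simp [B, S, U0])
    refine ⟨1, Runs.mono (e1.seq (e2.seq (e3.seq e4))) ?_, ?_⟩
    · simp only [un, List.length_replicate, List.length_nil, List.length_reverse, List.length_append,
        List.length_cons, Uconst]; omega
    · simp only [Nat.one_ne_zero, false_iff, UGood]
      rintro ⟨os', pay', htr', -, -⟩
      exact encClaims_append_ne_open (htr'.symm.trans htr)

/-- The verdict on a transcript that starts with a claim copy. [folklore] -/
theorem uGood_encClaims_append {P : UFlat.UProg} {K m inp out : ℕ} {ini : List Bool} {os : List ℕ}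
    {pay : List Bool} :
    UGood P K m inp out ini (encClaims os ++ pay) ↔
      (m * payTotal (encProg P).length (encClaims os).length K os ≤ pay.length ∧
        UFlat.UAccepts P m inp out ini os) := by
  constructor
  · rintro ⟨os', pay', h, hpay, hacc⟩
    obtain ⟨rfl, rfl⟩ := encClaims_append_inj h
    exact ⟨hpay, hacc⟩
  · rintro ⟨hpay, hacc⟩
    exact ⟨os, pay, rfl, hpay, hacc⟩

/-- **Soundness of the checker** (the form used by the diagonalizer): if `U` ends with `flag`
clear then the transcript begins with a claim copy `os` accepted by the `m`-pass check.
[cite: AroraBarak2009, Thm. 3.2 (proof)] -/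
theorem U_sound {P : UFlat.UProg} {K m inp out : ℕ} (hinp : inp ≤ K) (hout : out ≤ K) {ini tr : List Bool}
    {fl : ℕ} (h : Runs U (U0 P K m inp out ini tr).store
      { (U0 P K m inp out ini tr) with tr := [], np := [], flag := un fl }.store
      (Uconst * ((encProg P).length + tr.length + ini.length + m) + Uconst))
    (hfl : fl = 0) : ∃ (os : List ℕ) (pay : List Bool), tr = encClaims os ++ pay ∧ UFlat.UAccepts P m inp out ini os := by
  obtain ⟨fl', h', hiff⟩ := runs_U P K m inp out hinp hout ini tr
  -- the run is deterministic: `fl' = fl`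
  obtain ⟨t, -, e⟩ := h
  obtain ⟨t', -, e'⟩ := h'
  have heq := (e.determ e').1
  have hflag := congrFun heq UR.flag
  simp only [USt.store, un] at hflag
  have : fl = fl' := by simpa using congrArg List.length hflag
  subst this
  obtain ⟨os, pay, htr, -, hacc⟩ := hiff.1 hfl
  exact ⟨os, pay, htr, hacc⟩

/-- **Completeness of the checker**: a correctly paid claim copy accepted by the `m`-pass check
makes `U` end with `flag` clear. [cite: AroraBarak2009, Thm. 3.2 (proof)] -/
theorem U_complete {P : UFlat.UProg} {K m inp out : ℕ} (hinp : inp ≤ K) (hout : out ≤ K) {ini : List Bool}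
    {os : List ℕ} {pay : List Bool}
    (hpay : m * payTotal (encProg P).length (encClaims os).length K os ≤ pay.length)
    (hacc : UFlat.UAccepts P m inp out ini os) :
    Runs U (U0 P K m inp out ini (encClaims os ++ pay)).store
      { (U0 P K m inp out ini (encClaims os ++ pay)) with tr := [], np := [], flag := [] }.store
      (Uconst * ((encProg P).length + (encClaims os ++ pay).length + ini.length + m) + Uconst) := by
  obtain ⟨fl, h, hiff⟩ := runs_U P K m inp out hinp hout ini (encClaims os ++ pay)
  have hfl : fl = 0 := hiff.2 (uGood_encClaims_append.2 ⟨hpay, hacc⟩)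
  subst hfl
  simpa [un] using h

end UChk

end Literature.Computability.Complexity
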